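import Mathlib
import Literature.MathematicalPhysics.QuantumLattice.OverlapIndexTheorem
import Literature.MathematicalPhysics.QuantumLattice.RepLieAlgebraUnitary

/-!
# B9 p. 390 / p. 392: the conjugation `R(U)X = UXU⁻¹` is ORTHOGONAL for the trace form `X·Y = tr XY` — the
# standing component-orthogonality binder `hRm` of the `B9Thm37Glue*` lineage DISCHARGED for every unitary background

(cell `pub-balaban`, own-lineage located edge B9-RU-ORTHOGONAL of seat pv27; a leaf importing Mathlib and — for
landed [folklore] facts reused BY NAME per the gate's dedup rule — two tree modules under
`Literature.MathematicalPhysics.QuantumLattice`: `OverlapIndexTheorem` (`isUnit_det_of_mem_unitaryGroup`: a unitary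
matrix is invertible) and, since v1.2, `RepLieAlgebraUnitary` (`selfAdjointEquivSkewAdjoint`,
`finrank_skewAdjoint_submodule`, `finrank_skewAdjoint_inf_ker_trace`: `dim_ℝ 𝔲(n) = n²`, `dim_ℝ 𝔰𝔲(n) = n² − 1`,
kernel-proved there with the locator [cite: BrockerTomDieck1985, I (2.16) and (2.18)]); modifies nothing.)

CITATION HEADER (lean-in-tree rule).  T. Bałaban, *Propagators for lattice gauge theories in a background field*,
Comm. Math. Phys. **99** (1985) 389–434 [Balaban1985BackgroundPropagators] (= B9), renders of pp. 390–392 READ for this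
module: p. 390 «a norm |X| of a N × N matrix means the Hilbert–Schmidt norm: |X|² = tr X*X», «Let us recall that
R(U)X = UXU⁻¹», «(D^η_{U₀}A)(b) = η⁻¹(R(U₀(b))A(b₊) − A(b₋))»; p. 391 (3.5) «U(x, x′) = U⁻¹(x′, x), A(x, x′) = −A(x′, x)»;
pp. 391–392 (one sentence running from the foot of p. 391 onto p. 392; locator corrected in v1.2 after the cell's
cross-read, the p. 391 half re-read from the render) «The adjoints are taken with respect to natural L² scalar
products for functions with values in N × N hermitian matrices.  The inner product for these matrices is defined by
X·Y = tr XY.  Let us recall that the trace is normalized, i.e., tr 1 = 1»; p. 392 (3.8) «(D*A)(x) = Σ_{μ=1}^d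
η⁻¹(R(U(x, x − ηe_μ))A(x − ηe_μ, x) − A(x, x + ηe_μ))», «For U with values in the unitary group U(N) it is a hermitian
operator».  T. Bałaban, *Averaging operations for lattice gauge theories*,
Comm. Math. Phys. **98** (1985) 17–51 [Balaban1985Averaging] (= B7), p. 27 (56)–(57): «where for arbitrary invertible
matrix X the operator R(X) is given by the formula R(X)Y = XYX⁻¹.» «R(X)R(Y) = R(XY), R(X)⁻¹ = R(X⁻¹), R(X)* = R(X*).»
(this B7 quotation is RE-USED from a locus already render-certified in the cell, GAPS C-pv04g7-1, module
`T4AdjointCovariance`; it is context only).  Every quotation is an UNDISPUTED definition / elementary identity of the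
print; nothing under adjudication is cited.  Standard facts: Mathlib (`Matrix.nonsing_inv`, `Matrix.trace_mul_comm`,
`Matrix.unitaryGroup`, `Matrix.isHermitian_mul_mul_conjTranspose`, `stdOrthonormalBasis`, `Submodule.finrank_mono`)
and the tree's [folklore] `Literature.MathematicalPhysics.QuantumLattice.isUnit_det_of_mem_unitaryGroup`,
`.selfAdjointEquivSkewAdjoint`, `.finrank_skewAdjoint_submodule`, `.finrank_skewAdjoint_inf_ker_trace` (v1.2); Mathlib
`Matrix.single` / `Matrix.trace_single_mul` / `Matrix.conjTranspose_single`, `basisOfLinearIndependentOfCardEqFinrank'`,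
`Finset.offDiag_card`, `Fintype.equivFinOfCardEq` (v1.3).

WHAT THE KERNEL PROVES (every declaration [folklore]; a `[cite:]` tag is a LOCATOR of the printed formula whose
elementary property is proved, never a claim about the paper's estimates).
* §1 `R U X = U * X * U⁻¹` LITERALLY (Mathlib's nonsingular inverse; for `U ∈ U(N)`: `U⁻¹ = U*`, `R_eq_of_mem`).  For
  INVERTIBLE `U` (B7's generality): real-linearity (`Rₗ`), `R U 1 = 1`, `R U (XY) = R U X · R U Y`, B7 (57)
  `R U (R V X) = R (UV) X` / `R U⁻¹ (R U X) = X`, `tr R(U)X = tr X`, INVARIANCE OF THE TRACE FORM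
  `tr (R U X)(R U Y) = tr XY` (`trace_R_mul_R`) and the ADJOINT IDENTITY `tr X·R(U)Y = tr R(U⁻¹)X·Y` (`trace_mul_R`:
  the transpose of R(U) for `X·Y = tr XY` is R(U⁻¹) — the algebra behind reading (3.8) with (3.5) as the adjoint of
  (3.3)).  For UNITARY `U`: `(R U X)* = R U X*`, hermitian ↦ hermitian, traceless ↦ traceless (the real subspaces
  `herm n` ⊇ `herm0 n` of the physicists' u(N) ⊇ su(N) are `R(U)`-stable), and the Hilbert–Schmidt form is invariant,
  `tr (R U X)*(R U Y) = tr X*Y` (p. 390's |·|; reading (a) of the tree's `B9Eq3169MuN`).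
* §2 ABSTRACT PARSEVAL: for a real bilinear form `φ`, a finite family `e` ORTHONORMAL for `φ` and COMPLETE on a subspace
  `P` (`Σ_k φ(e_k, X) e_k = X` on `P`), and ANY map `T` with `T P ⊆ P` preserving `φ` on `P`, the component matrix
  `Rm_{ki} = φ(e_k, T e_i)` has orthonormal columns: `Σ_k Rm_{ki} Rm_{kj} = δ_{ij}` (`comp_orthogonal`).
* §3 THE DISCHARGE.  With `form c X Y = c · Re tr(XY)` (`c = 1/N` is the print's normalised trace; any `c` works) and
  `compMat c e U b k i = form c (e k) (R (U b) (e i))` — the matrix of R(U(b)) in the components `e` — for every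
  bond-indexed family `U b` of invertible matrices stabilising `P` (`compMat_orthogonal`), in particular for every
  `U b ∈ U(N)` on `herm n` (`compMat_orthogonal_herm`) and on `herm0 n` (`compMat_orthogonal_herm0`):
      `∀ b i j, ∑ k, compMat c e U b k i * compMat c e U b k j = if i = j then 1 else 0`
  — LITERALLY the binder `hRm : ∀ b i j, ∑ k, Rm b k i * Rm b k j = if i = j then 1 else 0` of
  `B9Thm37GlueSt` (`covDT_comp_leibRem_st`, …, `thm37_entry4_of_342_lattice_of_387_st`), `B9Thm37GlueSz`
  (`abs_Rm_le_one`, …), `B9Thm37GlueChart` (`thm37_entry4_chart`), `B9Thm37GluePU` (`thm37_entry4_torus`),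
  `B9Thm37GlueTorus` (`thm37_entry4_l1`, `thm37_entry4_l1_diag`), so far inhabited in the tree only
  at `U = 1` (`B9Thm37GlueTorus` §6), now for EVERY unitary background and every trace-orthonormal component family;
  plus the dictionary: `coord_R` (components transform by `Rm(b)`, the shape of `B9Thm37Glue.covD`), `compMat_inv` /
  `compMat_star` (the matrix of `R(U(b))⁻¹ = R(U(b)*)` is the TRANSPOSE of `Rm(b)` — `B9Thm37Glue.covDT`'s reading of
  (3.8)), and row-orthonormality `Σ_k Rm_{ik} Rm_{jk} = δ_{ij}` (`compMat_orthogonal_rows_herm`).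
* §4 NON-VACUITY beyond `U = 1`: su(2) with the Pauli matrices `σ₁, σ₂, σ₃`, `c = 1/2`: hermitian, traceless,
  `form`-orthonormal and complete on `herm0 (Fin 2)` (`pauli_complete`), so `hRm` holds hypothesis-free for every
  `U b ∈ U(2)` (`hRm_pauli`); and the rotation is non-trivial: `R σ₁ σ₃ = −σ₃`, `compMat (1/2) pauli σ₁ 2 2 = −1`.
* §5 (v1.1) EXISTENCE FOR EVERY `N`: for `c > 0` the trace form is DEFINITE on hermitian matrices
  (`form_self_nonneg`, `eq_zero_of_form_self_eq_zero` — p. 392's «X·Y = tr XY» IS an inner product on 𝔤), so by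
  Gram–Schmidt (Mathlib's `stdOrthonormalBasis` for the inner product `form c` on `P`) EVERY real subspace `P` of
  hermitian matrices carries a `form c`-orthonormal complete family `e : Fin (dim_ℝ P) → P`
  (`exists_orthonormal_complete`); hence the hypotheses of `compMat_orthogonal_herm` / `_herm0` are inhabited for
  every `N` and `hRm` holds for EVERY unitary background in SOME trace-orthonormal hermitian (resp. traceless
  hermitian) component family (`exists_hRm_herm`, `exists_hRm_herm0`).
* §6 (v1.2) THE COMPONENT COUNT PINNED: `herm n` is Mathlib's `selfAdjoint.submodule ℝ` (`herm_eq_selfAdjoint`),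
  `dim_ℝ (herm n) = N²` (`finrank_herm`), `herm0 n ≃ₗ[ℝ] skewAdjoint ⊓ ker tr` (= 𝔰𝔲) by `X ↦ iX` (`herm0EquivSu`),
  `dim_ℝ (herm0 n) = N² − 1` (`finrank_herm0`), and every real subspace of hermitian matrices has `dim_ℝ ≤ N²`
  (`finrank_le_of_herm`); Gram–Schmidt with the index type PINNED to `Fin (dim_ℝ P)`
  (`exists_orthonormal_complete_finrank`) and transport along an equality of cardinalities (`family_transport`),
  so `hRm` holds for EVERY unitary background with the component type `Cp = Fin (N²)` on u(N)
  (`exists_hRm_herm_sq`, `exists_hRm_uN`) and `Cp = Fin (N² − 1)` on su(N) (`exists_hRm_herm0_sq`,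
  `exists_hRm_suN`) — the `Fintype.card Cp` entering the prefactor `d + d · card Cp` of
  `B9Thm37GlueTorus.thm37_entry4_l1(_diag)` is thereby `N²` resp. `N² − 1`, a function of `N` alone
  (`glue_prefactor_uN : … = d (N² + 1)`, `glue_prefactor_suN : … = d N²`, and `glue_prefactor_le : … ≤ d (N² + 1)`
  for any hermitian 𝔤 ⊆ u(N)); no Glue file is imported or altered.
* §7 (v1.3) THE EXPLICIT FAMILIES FOR EVERY `N` (closing HONEST SCOPE (iii) of v1–v1.2): the GENERALIZED GELL-MANN
  matrices — `(E_{jk} + E_{kj})/√2`, `(−iE_{jk} + iE_{kj})/√2` for `j < k` and `diag(1,…,1,−(l+1),0,…,0)/√((l+1)(l+2))`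
  for `l < N − 1` (`gmS`, `gmA`, `gmD`; `gellMann : GMIndex N → M_N(ℂ)`; at `N = 2` they are `σ₁, σ₂, σ₃ /√2`:
  `gmS_fin_two`, `gmA_fin_two`, `gmD_fin_two`) — are traceless hermitian (`gellMann_mem`), TRACE-ORTHONORMAL
  `tr (gellMann a · gellMann b) = δ_{ab}` (`gellMann_orth`, an explicit entry computation) and exactly
  `card (GMIndex N) = N² − 1 = dim_ℝ su(N)` in number (`card_GMIndex`, with §6 `finrank_herm0`), hence COMPLETE on
  su(N) (`gellMann_complete`, through the abstract `complete_of_form_orthonormal_card_eq`: orthonormal + full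
  cardinality ⇒ basis); so `hRm` holds HYPOTHESIS-FREE for every `N` and every unitary background in these named
  components (`hRm_gellMann`, the all-`N` analogue of `hRm_pauli`), for every `c > 0` after the rescaling
  `gellMannC c = (√c)⁻¹ • gellMann` (`hRm_gellMannC`; `c = 1/N` is the print's normalised trace), with the index
  pinned to `Fin (N² − 1)` along any enumeration (`gellMannFin_spec`: the four clauses of `exists_hRm_suN` for the
  named family `gellMannFin c ε`, e.g. `ε = gmEnum N`), and on u(N) with the normalised identity `1/√N` adjoined
  (`gellMannU`, `gellMannU_orth`, `gellMannU_complete`, `hRm_gellMannU`, `gellMannUFin_spec`: the four clauses of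
  `exists_hRm_uN`, `N ≥ 1`).  v1.1/v1.2's existential (Gram–Schmidt) witnesses are thereby NAMED; nothing of §1–§6
  is altered.

HONEST SCOPE.  (i) No estimate and no statement of Theorem 3.7 / (3.42) is touched; this module only inhabits a
model hypothesis of the Glue lineage (value: bookkeeping / non-vacuity, NOT summit progress).  (ii) The identification
of 𝔤-valued lattice functions with real components is the MODEL's (cell record in `B9Thm37GlueSt`: "any faithful
real-linear coordinatisation will do"); here the components are taken trace-orthonormal, which is what makes `Rm(b)`
orthogonal — for a non-orthonormal faithful coordinatisation `hRm` is false in general (this module does not claim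
it).  (iii) Existence of a trace-orthonormal complete family for general `N` is proved in §5 (v1.1) EXISTENTIALLY
(Gram–Schmidt through Mathlib's `stdOrthonormalBasis`) and §6 (v1.2) pins only its CARDINALITY (`N²`, `N² − 1`,
`dim_ℝ P`); an EXPLICIT family (Gell-Mann type) is exhibited for su(2) in §4 and, since v1.3 (§7), for su(N) and u(N)
for EVERY `N` (generalized Gell-Mann); for a general hermitian 𝔤 = P ⊊ su(N) (a proper closed subgroup `G ⊂ U(N)`)
the family stays existential (§5/§6), and which family a consumer's model uses remains the consumer's datum.  (iv) Sibling,
not duplicated: `T4AdjointCovarianceUnitary` proves the SKEW-hermitian / Frobenius-inner-product isometry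
`unitaryAd g : 𝔲(n) ≃ₗᵢ[ℝ] 𝔲(n)`; the present module works with the print's bilinear `tr XY` on HERMITIAN matrices
(B9's convention, `exp iηA`) and proves the COMPONENT statement the Glue files consume.  (v) `R` uses the literal
`U⁻¹`; for singular `U` Mathlib's `U⁻¹ = 0` and the invertibility hypotheses are then essential (none is hidden).

REVISION LOG.  v1 = p185428 (commit 7173239b56bc, 2026-08-19): header + §1–§4.  v1.1 = p185529 (commit
29aa6950e137, 2026-08-19), APPEND-ONLY: §5 added — definiteness of the trace form on hermitian matrices and EXISTENCE
of trace-orthonormal complete families for every `N` (Mathlib: `Matrix.posSemidef_conjTranspose_mul_self`,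
`Matrix.trace_conjTranspose_mul_self_eq_zero_iff`, `InnerProductSpace.ofCore`, `stdOrthonormalBasis`,
`OrthonormalBasis.sum_repr'`); header bullet §5 added and HONEST SCOPE (iii) revised accordingly; §1–§4
byte-unchanged; no statement of v1 altered.  v1.2 = p185744 (commit 6027d442013b, 2026-08-19), APPEND-ONLY + one
`import` line: §6 added — the
COMPONENT COUNT (`herm_eq_selfAdjoint`, `finrank_herm`, `finrank_le_of_herm`, `herm0EquivSu`, `finrank_herm0`,
`exists_orthonormal_complete_finrank`, `family_transport`, `exists_hRm_herm_sq`, `exists_hRm_herm0_sq`,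
`exists_hRm_uN`, `exists_hRm_suN`, `glue_prefactor_suN` / `_uN` / `_le`), reusing BY NAME the tree's
`RepLieAlgebraUnitary` dimension theorems (the added import); header: first paragraph and standard-facts list name the
second import, bullet §6 added, HONEST SCOPE (iii) amended, and the locator of the inner-product sentence corrected to
pp. 391–392 with its p. 391 half now quoted (render re-read); §1–§5 byte-unchanged; no statement of v1 / v1.1 altered.
v1.3 (this revision, APPEND-ONLY, no new import): §7 added — the EXPLICIT generalized Gell-Mann component families for
every `N` (`dcoef`, `gmS`, `gmA`, `gmD`, `GMIndex`, `card_GMIndex`, `gellMann`, `gellMann_mem`, `gellMann_orth`,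
`gellMann_complete`, `hRm_gellMann`, `gellMannC`, `hRm_gellMannC`, `gmEnum`, `gellMannFin`, `gellMannFin_spec`,
`gellMannU`, `gellMannU_orth`, `gellMannU_complete`, `hRm_gellMannU`, `gmEnumU`, `gellMannUFin`, `gellMannUFin_spec`,
with the abstract `linearIndependent_of_form_orthonormal` / `complete_of_form_orthonormal_card_eq` and the reindexing /
rescaling lemmas `orth_reindex`, `complete_reindex`, `form_rescale`, `orth_rescale`, `complete_rescale`); header: bullet
§7 added, standard-facts list extended, HONEST SCOPE (iii) amended; §1–§6 byte-unchanged; no statement of v1 / v1.1 /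
v1.2 altered.
-/

noncomputable section

open Matrix
open Literature.MathematicalPhysics.QuantumLattice (isUnit_det_of_mem_unitaryGroup)

namespace Literature.MathematicalPhysics.QuantumFieldTheory.Balaban1983to89.B9AdOrthogonal

/-! ## §1 The conjugation `R(U)X = UXU⁻¹` -/

section Conjugation

variable {n : Type*} [Fintype n] [DecidableEq n]

/-- «Let us recall that R(U)X = UXU⁻¹» — with Mathlib's nonsingular inverse, so literally B7's «for arbitrary
invertible matrix X the operator R(X) is given by the formula R(X)Y = XYX⁻¹».
[cite: Balaban1985BackgroundPropagators, p.390; Balaban1985Averaging, (56) p.27] -/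
def R (U X : Matrix n n ℂ) : Matrix n n ℂ := U * X * U⁻¹

/-- Unfolding equation. [folklore] -/
theorem R_apply (U X : Matrix n n ℂ) : R U X = U * X * U⁻¹ := rfl

/-- `R(U)` is additive. [folklore] -/
theorem R_add (U X Y : Matrix n n ℂ) : R U (X + Y) = R U X + R U Y := by
  simp only [R, Matrix.mul_add, Matrix.add_mul]

/-- `R(U)` commutes with real scalars. [folklore] -/
theorem R_smul (U : Matrix n n ℂ) (r : ℝ) (X : Matrix n n ℂ) : R U (r • X) = r • R U X := by
  simp only [R, Matrix.mul_smul, Matrix.smul_mul]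

/-- `R(U) 0 = 0`. [folklore] -/
theorem R_zero (U : Matrix n n ℂ) : R U 0 = 0 := by
  simp only [R, Matrix.mul_zero, Matrix.zero_mul]

/-- `R(U)(−X) = −R(U)X`. [folklore] -/
theorem R_neg (U X : Matrix n n ℂ) : R U (-X) = -R U X := by
  simp only [R, Matrix.mul_neg, Matrix.neg_mul]

/-- `R(U)` as a real-linear map of `M_N(ℂ)` («R(u)A is linear in A», B9 p. 395). [folklore] -/
def Rₗ (U : Matrix n n ℂ) : Matrix n n ℂ →ₗ[ℝ] Matrix n n ℂ where
  toFun := R U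
  map_add' := R_add U
  map_smul' := R_smul U

/-- `Rₗ U X = R U X`. [folklore] -/
@[simp] theorem Rₗ_apply (U X : Matrix n n ℂ) : Rₗ U X = R U X := rfl

/-- `R(U)` of a finite linear combination. [folklore] -/
theorem R_sum_smul {ι : Type*} (s : Finset ι) (U : Matrix n n ℂ) (a : ι → ℝ) (X : ι → Matrix n n ℂ) :
    R U (∑ i ∈ s, a i • X i) = ∑ i ∈ s, a i • R U (X i) := by
  rw [← Rₗ_apply, map_sum]
  simp only [map_smul, Rₗ_apply]

/-- `R(U)1 = 1` for invertible `U`. [folklore] -/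
theorem R_one {U : Matrix n n ℂ} (hU : IsUnit U.det) : R U 1 = 1 := by
  rw [R, Matrix.mul_one, Matrix.mul_nonsing_inv _ hU]

/-- `R(U)` is multiplicative for invertible `U` («R(X)f(Y) = f(R(X)Y)» for polynomial f).
[cite: Balaban1985Averaging, (57) p.27] -/
theorem R_mul {U : Matrix n n ℂ} (hU : IsUnit U.det) (X Y : Matrix n n ℂ) : R U (X * Y) = R U X * R U Y := by
  simp only [R, Matrix.mul_assoc, Matrix.nonsing_inv_mul_cancel_left _ _ hU]

/-- «R(X)R(Y) = R(XY)» (no invertibility needed with Mathlib's conventions). [cite: Balaban1985Averaging, (57) p.27] -/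
theorem R_R (U V X : Matrix n n ℂ) : R U (R V X) = R (U * V) X := by
  simp only [R, Matrix.mul_inv_rev, Matrix.mul_assoc]

/-- «R(X)⁻¹ = R(X⁻¹)»: `R(U⁻¹)` undoes `R(U)` for invertible `U`. [cite: Balaban1985Averaging, (57) p.27] -/
theorem R_inv_R {U : Matrix n n ℂ} (hU : IsUnit U.det) (X : Matrix n n ℂ) : R U⁻¹ (R U X) = X := by
  simp only [R, Matrix.nonsing_inv_nonsing_inv _ hU, Matrix.mul_assoc, Matrix.nonsing_inv_mul_cancel_left _ _ hU,
    Matrix.nonsing_inv_mul _ hU, Matrix.mul_one]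

/-- `R(U)` undoes `R(U⁻¹)` for invertible `U`. [folklore] -/
theorem R_R_inv {U : Matrix n n ℂ} (hU : IsUnit U.det) (X : Matrix n n ℂ) : R U (R U⁻¹ X) = X := by
  have h := R_inv_R (Matrix.isUnit_nonsing_inv_det U hU) X
  rwa [Matrix.nonsing_inv_nonsing_inv _ hU] at h

/-- `tr R(U)X = tr X` for invertible `U` (in particular `R(U)` preserves tracelessness). [folklore] -/
theorem trace_R {U : Matrix n n ℂ} (hU : IsUnit U.det) (X : Matrix n n ℂ) : trace (R U X) = trace X := by
  rw [R, Matrix.trace_mul_cycle, Matrix.nonsing_inv_mul _ hU, Matrix.one_mul]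

/-- **Invariance of the trace form** «X·Y = tr XY» under `R(U)`, `U` invertible: `tr (R U X)(R U Y) = tr XY`.
[cite: Balaban1985BackgroundPropagators, p.392] -/
theorem trace_R_mul_R {U : Matrix n n ℂ} (hU : IsUnit U.det) (X Y : Matrix n n ℂ) :
    trace (R U X * R U Y) = trace (X * Y) := by
  rw [← R_mul hU, trace_R hU]

/-- **The adjoint of `R(U)` for the trace form is `R(U⁻¹)`**: `tr X·R(U)Y = tr R(U⁻¹)X·Y` — the algebra by which
(3.8) (with «U(x, x′) = U⁻¹(x′, x)», (3.5)) is the adjoint of (3.3); B7: «R(X)* = R(X*)» (= R(X⁻¹) for unitary X).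
[cite: Balaban1985BackgroundPropagators, (3.8) p.392 + (3.5) p.391; Balaban1985Averaging, (57) p.27] -/
theorem trace_mul_R {U : Matrix n n ℂ} (hU : IsUnit U.det) (X Y : Matrix n n ℂ) :
    trace (X * R U Y) = trace (R U⁻¹ X * Y) := by
  simp only [R, Matrix.nonsing_inv_nonsing_inv _ hU, ← Matrix.mul_assoc]
  rw [Matrix.trace_mul_comm (X * U * Y) U⁻¹, ← Matrix.mul_assoc, ← Matrix.mul_assoc]

/-! ### Unitary `U` -/

/-- For `U ∈ U(N)`: `U*U = 1`. [folklore] -/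
theorem star_mul_of_mem {U : Matrix n n ℂ} (hU : U ∈ Matrix.unitaryGroup n ℂ) : star U * U = 1 :=
  Matrix.mem_unitaryGroup_iff'.mp hU

/-- For `U ∈ U(N)`: `U⁻¹ = U*`. [folklore] -/
theorem inv_eq_star_of_mem {U : Matrix n n ℂ} (hU : U ∈ Matrix.unitaryGroup n ℂ) : U⁻¹ = star U :=
  Matrix.inv_eq_left_inv (star_mul_of_mem hU)

/-- The inverse (= adjoint) of a unitary matrix is unitary. [folklore] -/
theorem inv_mem_of_mem {U : Matrix n n ℂ} (hU : U ∈ Matrix.unitaryGroup n ℂ) : U⁻¹ ∈ Matrix.unitaryGroup n ℂ := by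
  rw [inv_eq_star_of_mem hU]
  exact Unitary.star_mem hU

/-- For `U ∈ U(N)`: `R U X = U X U*`. [cite: Balaban1985BackgroundPropagators, p.390] -/
theorem R_eq_of_mem {U : Matrix n n ℂ} (hU : U ∈ Matrix.unitaryGroup n ℂ) (X : Matrix n n ℂ) :
    R U X = U * X * star U := by
  rw [R, inv_eq_star_of_mem hU]

/-- For `U ∈ U(N)`: `(R U X)* = R U X*`. [folklore] -/
theorem star_R {U : Matrix n n ℂ} (hU : U ∈ Matrix.unitaryGroup n ℂ) (X : Matrix n n ℂ) :
    star (R U X) = R U (star X) := by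
  rw [R_eq_of_mem hU, R_eq_of_mem hU, star_mul, star_mul, star_star, Matrix.mul_assoc]

/-- «For U with values in the unitary group U(N)»: `R(U)` maps hermitian matrices to hermitian matrices.
[cite: Balaban1985BackgroundPropagators, p.392] -/
theorem isHermitian_R {U : Matrix n n ℂ} (hU : U ∈ Matrix.unitaryGroup n ℂ) {X : Matrix n n ℂ}
    (hX : X.IsHermitian) : (R U X).IsHermitian := by
  rw [R_eq_of_mem hU, Matrix.star_eq_conjTranspose]
  exact Matrix.isHermitian_mul_mul_conjTranspose U hX

/-- **Invariance of the Hilbert–Schmidt form** «|X|² = tr X*X» under `R(U)`, `U ∈ U(N)`: `tr (R U X)*(R U Y) = tr X*Y`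
(reading (a) of `B9Eq3169MuN`: R(U) is an isometry of (𝔤, |·|)). [cite: Balaban1985BackgroundPropagators, p.390] -/
theorem trace_star_R_mul_R {U : Matrix n n ℂ} (hU : U ∈ Matrix.unitaryGroup n ℂ) (X Y : Matrix n n ℂ) :
    trace (star (R U X) * R U Y) = trace (star X * Y) := by
  rw [star_R hU, trace_R_mul_R (isUnit_det_of_mem_unitaryGroup hU)]

/-- THE HERMITIAN MATRICES as a real subspace of `M_N(ℂ)` (the physicists' u(N): `U = exp(iηA)`, A hermitian —
B9's convention). [folklore] -/
def herm (n : Type*) : Submodule ℝ (Matrix n n ℂ) where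
  carrier := {X | X.IsHermitian}
  zero_mem' := Matrix.isHermitian_zero
  add_mem' hX hY := hX.add hY
  smul_mem' r X hX := by
    show (r • X).IsHermitian
    unfold Matrix.IsHermitian
    rw [Matrix.conjTranspose_smul, star_trivial, hX.eq]

omit [Fintype n] [DecidableEq n] in
/-- Membership in `herm n`. [folklore] -/
theorem mem_herm {X : Matrix n n ℂ} : X ∈ herm n ↔ X.IsHermitian := Iff.rfl

/-- THE TRACELESS HERMITIAN MATRICES (the physicists' su(N)) as a real subspace of `M_N(ℂ)`. [folklore] -/
def herm0 (n : Type*) [Fintype n] : Submodule ℝ (Matrix n n ℂ) where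
  carrier := {X | X.IsHermitian ∧ trace X = 0}
  zero_mem' := ⟨Matrix.isHermitian_zero, Matrix.trace_zero n ℂ⟩
  add_mem' := by
    rintro X Y ⟨hX, hX0⟩ ⟨hY, hY0⟩
    exact ⟨hX.add hY, by rw [Matrix.trace_add, hX0, hY0, add_zero]⟩
  smul_mem' := by
    rintro r X ⟨hX, hX0⟩
    refine ⟨?_, by rw [Matrix.trace_smul, hX0, smul_zero]⟩
    unfold Matrix.IsHermitian
    rw [Matrix.conjTranspose_smul, star_trivial, hX.eq]

omit [DecidableEq n] in
/-- Membership in `herm0 n`. [folklore] -/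
theorem mem_herm0 {X : Matrix n n ℂ} : X ∈ herm0 n ↔ X.IsHermitian ∧ trace X = 0 := Iff.rfl

/-- `R(U)`, `U ∈ U(N)`, preserves `herm n`. [folklore] -/
theorem R_mem_herm {U : Matrix n n ℂ} (hU : U ∈ Matrix.unitaryGroup n ℂ) {X : Matrix n n ℂ} (hX : X ∈ herm n) :
    R U X ∈ herm n :=
  isHermitian_R hU hX

/-- `R(U)`, `U ∈ U(N)`, preserves `herm0 n`. [folklore] -/
theorem R_mem_herm0 {U : Matrix n n ℂ} (hU : U ∈ Matrix.unitaryGroup n ℂ) {X : Matrix n n ℂ} (hX : X ∈ herm0 n) :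
    R U X ∈ herm0 n :=
  ⟨isHermitian_R hU hX.1, by rw [trace_R (isUnit_det_of_mem_unitaryGroup hU), hX.2]⟩

omit [DecidableEq n] in
/-- On hermitian matrices the trace form «X·Y = tr XY» is REAL. [folklore] -/
theorem im_trace_mul_eq_zero {X Y : Matrix n n ℂ} (hX : X.IsHermitian) (hY : Y.IsHermitian) :
    (trace (X * Y)).im = 0 := by
  have h : star (trace (X * Y)) = trace (X * Y) := by
    rw [← Matrix.trace_conjTranspose, Matrix.conjTranspose_mul, hX.eq, hY.eq, Matrix.trace_mul_comm]
  exact Complex.conj_eq_iff_im.mp h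

end Conjugation

/-! ## §2 Abstract Parseval: the component matrix of a form-preserving map in an orthonormal complete family -/

section Parseval

variable {M : Type*} [AddCommGroup M] [Module ℝ M] {ι : Type*} [Fintype ι]

/-- PARSEVAL for a real bilinear form: if `A = Σ_k φ(e_k, A) e_k` then `Σ_k φ(e_k, A) φ(e_k, B) = φ(A, B)`
(bilinearity in the first argument only; no symmetry or definiteness is used). [folklore] -/
theorem parseval (φ : M →ₗ[ℝ] M →ₗ[ℝ] ℝ) (e : ι → M) {A : M} (hA : ∑ k, φ (e k) A • e k = A) (B : M) :
    ∑ k, φ (e k) A * φ (e k) B = φ A B := by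
  conv_rhs => rw [← hA]
  rw [map_sum, LinearMap.sum_apply]
  refine Finset.sum_congr rfl fun k _ => ?_
  rw [map_smul, LinearMap.smul_apply, smul_eq_mul]

/-- **Orthonormal complete family + form-preserving map ⇒ ORTHOGONAL component matrix.**  For `e` orthonormal for
`φ` and complete on the subspace `P`, and any `T` mapping `P` into `P` and preserving `φ` on `P`, the matrix
`Rm_{ki} = φ(e_k, T e_i)` satisfies `Σ_k Rm_{ki} Rm_{kj} = δ_{ij}`. [folklore] -/
theorem comp_orthogonal [DecidableEq ι] (φ : M →ₗ[ℝ] M →ₗ[ℝ] ℝ) (P : Submodule ℝ M) (e : ι → M)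
    (he : ∀ k, e k ∈ P) (horth : ∀ k l, φ (e k) (e l) = if k = l then 1 else 0)
    (hcompl : ∀ X ∈ P, ∑ k, φ (e k) X • e k = X) (T : M → M) (hT : ∀ X ∈ P, T X ∈ P)
    (hinv : ∀ X ∈ P, ∀ Y ∈ P, φ (T X) (T Y) = φ X Y) (i j : ι) :
    ∑ k, φ (e k) (T (e i)) * φ (e k) (T (e j)) = if i = j then 1 else 0 := by
  rw [parseval φ e (hcompl _ (hT _ (he i))), hinv _ (he i) _ (he j), horth]

/-- COORDINATES TRANSFORM BY THE COMPONENT MATRIX: for `X ∈ P` and `T` real-linear,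
`φ(e_k, T X) = Σ_i φ(e_k, T e_i) φ(e_i, X)`. [folklore] -/
theorem coord_map (φ : M →ₗ[ℝ] M →ₗ[ℝ] ℝ) (P : Submodule ℝ M) (e : ι → M)
    (hcompl : ∀ X ∈ P, ∑ k, φ (e k) X • e k = X) (T : M →ₗ[ℝ] M) {X : M} (hX : X ∈ P) (k : ι) :
    φ (e k) (T X) = ∑ i, φ (e k) (T (e i)) * φ (e i) X := by
  conv_lhs => rw [← hcompl X hX, map_sum, map_sum]
  refine Finset.sum_congr rfl fun i _ => ?_
  rw [map_smul, map_smul, smul_eq_mul, mul_comm]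

end Parseval

/-! ## §3 The discharge of `hRm`: the matrices of `R(U(b))` in trace-orthonormal components are orthogonal -/

section Components

variable {n : Type*} [Fintype n] [DecidableEq n]

/-- THE TRACE FORM «X·Y = tr XY» scaled by `c` (print: `c = 1/N`, «the trace is normalized, i.e., tr 1 = 1»), as a
real bilinear form on `M_N(ℂ)` (real part taken; on hermitian matrices `tr XY` is already real,
`im_trace_mul_eq_zero`). [cite: Balaban1985BackgroundPropagators, p.392] -/
def form (c : ℝ) : Matrix n n ℂ →ₗ[ℝ] Matrix n n ℂ →ₗ[ℝ] ℝ :=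
  LinearMap.mk₂ ℝ (fun X Y => c * (trace (X * Y)).re)
    (fun X X' Y => by simp only [Matrix.add_mul, Matrix.trace_add, Complex.add_re]; ring)
    (fun r X Y => by simp only [Matrix.smul_mul, Matrix.trace_smul, Complex.smul_re, smul_eq_mul]; ring)
    (fun X Y Y' => by simp only [Matrix.mul_add, Matrix.trace_add, Complex.add_re]; ring)
    (fun r X Y => by simp only [Matrix.mul_smul, Matrix.trace_smul, Complex.smul_re, smul_eq_mul]; ring)

omit [DecidableEq n] in
/-- Unfolding equation of `form`. [folklore] -/
@[simp] theorem form_apply (c : ℝ) (X Y : Matrix n n ℂ) : form c X Y = c * (trace (X * Y)).re := rfl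

omit [DecidableEq n] in
/-- The trace form is symmetric. [folklore] -/
theorem form_comm (c : ℝ) (X Y : Matrix n n ℂ) : form c X Y = form c Y X := by
  rw [form_apply, form_apply, Matrix.trace_mul_comm]

/-- The trace form is `R(U)`-invariant for invertible `U`. [cite: Balaban1985BackgroundPropagators, p.392] -/
theorem form_R_R {U : Matrix n n ℂ} (hU : IsUnit U.det) (c : ℝ) (X Y : Matrix n n ℂ) :
    form c (R U X) (R U Y) = form c X Y := by
  rw [form_apply, form_apply, trace_R_mul_R hU]

/-- The `form`-adjoint of `R(U)` is `R(U⁻¹)`. [cite: Balaban1985BackgroundPropagators, (3.8) p.392] -/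
theorem form_R_right {U : Matrix n n ℂ} (hU : IsUnit U.det) (c : ℝ) (X Y : Matrix n n ℂ) :
    form c X (R U Y) = form c (R U⁻¹ X) Y := by
  rw [form_apply, form_apply, trace_mul_R hU]

variable {Bd ι : Type*} [Fintype ι]

/-- **THE COMPONENT MATRICES OF THE BACKGROUND ROTATIONS**: `compMat c e U b k i = e_k · R(U(b)) e_i` — the real
matrix `Rm(b)` of `R(U(b))` in the component family `e` (the `Rm : Bd → Cp → Cp → ℝ` of `B9Thm37Glue.covD` /
`covDT`: «(D^η_{U₀}A)(b) = η⁻¹(R(U₀(b))A(b₊) − A(b₋))» read in components).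
[cite: Balaban1985BackgroundPropagators, (3.3) pp.390–391] -/
def compMat (c : ℝ) (e : ι → Matrix n n ℂ) (U : Bd → Matrix n n ℂ) : Bd → ι → ι → ℝ :=
  fun b k i => form c (e k) (R (U b) (e i))

omit [Fintype ι] in
/-- Unfolding equation of `compMat`. [folklore] -/
theorem compMat_apply (c : ℝ) (e : ι → Matrix n n ℂ) (U : Bd → Matrix n n ℂ) (b : Bd) (k i : ι) :
    compMat c e U b k i = c * (trace (e k * R (U b) (e i))).re := rfl

/-- **`hRm` DISCHARGED (general form)**: for a component family `e` which is `form c`-orthonormal and complete on a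
real subspace `P ∋ e_k`, and bond matrices `U(b)` invertible with `R(U(b))P ⊆ P`, the component matrices are
orthogonal: `∀ b i j, Σ_k Rm(b)_{ki} Rm(b)_{kj} = δ_{ij}` — literally the binder `hRm` of `B9Thm37GlueSt` /
`B9Thm37GlueSz` / `B9Thm37GlueChart` / `B9Thm37GluePU` / `B9Thm37GlueTorus` with `Rm := compMat c e U`.
[cite: Balaban1985BackgroundPropagators, p.390 + p.392] -/
theorem compMat_orthogonal [DecidableEq ι] (c : ℝ) (P : Submodule ℝ (Matrix n n ℂ)) (e : ι → Matrix n n ℂ)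
    (he : ∀ k, e k ∈ P) (horth : ∀ k l, form c (e k) (e l) = if k = l then 1 else 0)
    (hcompl : ∀ X ∈ P, ∑ k, form c (e k) X • e k = X) (U : Bd → Matrix n n ℂ) (hU : ∀ b, IsUnit (U b).det)
    (hP : ∀ b, ∀ X ∈ P, R (U b) X ∈ P) :
    ∀ b i j, ∑ k, compMat c e U b k i * compMat c e U b k j = if i = j then 1 else 0 :=
  fun b i j => comp_orthogonal (form c) P e he horth hcompl (R (U b)) (hP b)
    (fun X _ Y _ => form_R_R (hU b) c X Y) i j

/-- **`hRm` DISCHARGED on u(N)**: trace-orthonormal complete hermitian components, ANY unitary background `U(b) ∈ U(N)`.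
[cite: Balaban1985BackgroundPropagators, p.390 + p.392] -/
theorem compMat_orthogonal_herm [DecidableEq ι] (c : ℝ) (e : ι → Matrix n n ℂ) (he : ∀ k, (e k).IsHermitian)
    (horth : ∀ k l, form c (e k) (e l) = if k = l then 1 else 0)
    (hcompl : ∀ X : Matrix n n ℂ, X.IsHermitian → ∑ k, form c (e k) X • e k = X)
    (U : Bd → Matrix n n ℂ) (hU : ∀ b, U b ∈ Matrix.unitaryGroup n ℂ) :
    ∀ b i j, ∑ k, compMat c e U b k i * compMat c e U b k j = if i = j then 1 else 0 :=
  compMat_orthogonal c (herm n) e he horth (fun X hX => hcompl X hX) U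
    (fun b => isUnit_det_of_mem_unitaryGroup (hU b)) fun b _ hX => R_mem_herm (hU b) hX

/-- **`hRm` DISCHARGED on su(N)**: trace-orthonormal complete traceless hermitian components, ANY unitary background.
[cite: Balaban1985BackgroundPropagators, p.390 + p.392] -/
theorem compMat_orthogonal_herm0 [DecidableEq ι] (c : ℝ) (e : ι → Matrix n n ℂ)
    (he : ∀ k, (e k).IsHermitian ∧ trace (e k) = 0)
    (horth : ∀ k l, form c (e k) (e l) = if k = l then 1 else 0)
    (hcompl : ∀ X : Matrix n n ℂ, X.IsHermitian → trace X = 0 → ∑ k, form c (e k) X • e k = X)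
    (U : Bd → Matrix n n ℂ) (hU : ∀ b, U b ∈ Matrix.unitaryGroup n ℂ) :
    ∀ b i j, ∑ k, compMat c e U b k i * compMat c e U b k j = if i = j then 1 else 0 :=
  compMat_orthogonal c (herm0 n) e he horth (fun X hX => hcompl X hX.1 hX.2) U
    (fun b => isUnit_det_of_mem_unitaryGroup (hU b)) fun b _ hX => R_mem_herm0 (hU b) hX

/-- DICTIONARY (the shape of `B9Thm37Glue.covD`): in components, `R(U(b))` acts by the matrix `Rm(b)` —
`e_k · R(U(b))X = Σ_i Rm(b)_{ki} (e_i · X)` for `X ∈ P`. [cite: Balaban1985BackgroundPropagators, (3.3) pp.390–391] -/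
theorem coord_R (c : ℝ) (P : Submodule ℝ (Matrix n n ℂ)) (e : ι → Matrix n n ℂ)
    (hcompl : ∀ X ∈ P, ∑ k, form c (e k) X • e k = X) (U : Bd → Matrix n n ℂ) (b : Bd) {X : Matrix n n ℂ}
    (hX : X ∈ P) (k : ι) :
    form c (e k) (R (U b) X) = ∑ i, compMat c e U b k i * form c (e i) X := by
  have h := coord_map (form c) P e hcompl (Rₗ (U b)) hX k
  simpa only [Rₗ_apply, compMat] using h

omit [Fintype ι] in
/-- DICTIONARY (the shape of `B9Thm37Glue.covDT`, (3.8) with (3.5) «U(x, x′) = U⁻¹(x′, x)»): the component matrix of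
`R(U(b))⁻¹ = R(U(b)⁻¹)` is the TRANSPOSE of `Rm(b)`.
[cite: Balaban1985BackgroundPropagators, (3.8) p.392 + (3.5) p.391] -/
theorem compMat_inv (c : ℝ) (e : ι → Matrix n n ℂ) (U : Bd → Matrix n n ℂ) (hU : ∀ b, IsUnit (U b).det)
    (b : Bd) (k i : ι) : compMat c e (fun b => (U b)⁻¹) b k i = compMat c e U b i k := by
  simp only [compMat]
  rw [form_R_right (Matrix.isUnit_nonsing_inv_det _ (hU b)), Matrix.nonsing_inv_nonsing_inv _ (hU b), form_comm]

omit [Fintype ι] in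
/-- The same for a unitary background, `U(b)⁻¹ = U(b)*`. [folklore] -/
theorem compMat_star (c : ℝ) (e : ι → Matrix n n ℂ) (U : Bd → Matrix n n ℂ)
    (hU : ∀ b, U b ∈ Matrix.unitaryGroup n ℂ) (b : Bd) (k i : ι) :
    compMat c e (fun b => star (U b)) b k i = compMat c e U b i k := by
  rw [← compMat_inv c e U (fun b => isUnit_det_of_mem_unitaryGroup (hU b)) b k i]
  simp only [compMat, inv_eq_star_of_mem (hU b)]

/-- ROW orthonormality `Σ_k Rm(b)_{ik} Rm(b)_{jk} = δ_{ij}` (`Rm(b) Rm(b)ᵀ = 1`) on u(N): the columns of the matrix of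
`R(U(b)*)`. [folklore] -/
theorem compMat_orthogonal_rows_herm [DecidableEq ι] (c : ℝ) (e : ι → Matrix n n ℂ) (he : ∀ k, (e k).IsHermitian)
    (horth : ∀ k l, form c (e k) (e l) = if k = l then 1 else 0)
    (hcompl : ∀ X : Matrix n n ℂ, X.IsHermitian → ∑ k, form c (e k) X • e k = X)
    (U : Bd → Matrix n n ℂ) (hU : ∀ b, U b ∈ Matrix.unitaryGroup n ℂ) :
    ∀ b i j, ∑ k, compMat c e U b i k * compMat c e U b j k = if i = j then 1 else 0 := by
  intro b i j
  have h := compMat_orthogonal_herm c e he horth hcompl (fun b => star (U b)) (fun b => Unitary.star_mem (hU b)) b i j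
  simpa only [compMat_star c e U hU] using h

end Components

/-! ## §4 Non-vacuity beyond `U = 1`: su(2) in the Pauli components -/

section Pauli

/-- Pauli matrix σ₁. [folklore] -/
def σ₁ : Matrix (Fin 2) (Fin 2) ℂ := !![0, 1; 1, 0]

/-- Pauli matrix σ₂. [folklore] -/
def σ₂ : Matrix (Fin 2) (Fin 2) ℂ := !![0, -Complex.I; Complex.I, 0]

/-- Pauli matrix σ₃. [folklore] -/
def σ₃ : Matrix (Fin 2) (Fin 2) ℂ := !![1, 0; 0, -1]

/-- The Pauli component family of su(2). [folklore] -/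
def pauli : Fin 3 → Matrix (Fin 2) (Fin 2) ℂ := ![σ₁, σ₂, σ₃]

/-- Component 0 is σ₁. [folklore] -/
@[simp] theorem pauli_zero : pauli 0 = σ₁ := rfl

/-- Component 1 is σ₂. [folklore] -/
@[simp] theorem pauli_one : pauli 1 = σ₂ := rfl

/-- Component 2 is σ₃. [folklore] -/
@[simp] theorem pauli_two : pauli 2 = σ₃ := rfl

/-- The Pauli matrices are hermitian. [folklore] -/
theorem pauli_isHermitian : ∀ k, (pauli k).IsHermitian := by
  intro k
  fin_cases k <;>
  · refine Matrix.IsHermitian.ext fun i j => ?_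
    fin_cases i <;> fin_cases j <;> simp [pauli, σ₁, σ₂, σ₃]

/-- The Pauli matrices are traceless. [folklore] -/
theorem pauli_trace : ∀ k, trace (pauli k) = 0 := by
  intro k
  fin_cases k <;> simp [pauli, σ₁, σ₂, σ₃, Matrix.trace_fin_two]

/-- The Pauli matrices are orthonormal for `form (1/2)` (`½ tr σ_k σ_l = δ_{kl}`). [folklore] -/
theorem pauli_orth : ∀ k l, form (1 / 2 : ℝ) (pauli k) (pauli l) = if k = l then 1 else 0 := by
  intro k l
  fin_cases k <;> fin_cases l <;>
    simp [form_apply, pauli, σ₁, σ₂, σ₃, Matrix.trace_fin_two] <;> norm_num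

/-- Completeness in the explicit parametrisation of a traceless hermitian 2 × 2 matrix. [folklore] -/
theorem pauli_complete' (a : ℝ) (z : ℂ) :
    ∑ k, form (1 / 2 : ℝ) (pauli k) !![(a : ℂ), z; starRingEnd ℂ z, -(a : ℂ)] • pauli k =
      !![(a : ℂ), z; starRingEnd ℂ z, -(a : ℂ)] := by
  ext i j
  fin_cases i <;> fin_cases j <;>
    simp [Fin.sum_univ_three, Matrix.sum_apply, form_apply, pauli, σ₁, σ₂, σ₃, Matrix.trace_fin_two,
      Matrix.mul_apply, Fin.sum_univ_two, Matrix.smul_apply, Complex.ext_iff] <;> (try constructor) <;> ring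

/-- A traceless hermitian 2 × 2 matrix in the explicit parametrisation. [folklore] -/
theorem eq_param_of_herm0 {X : Matrix (Fin 2) (Fin 2) ℂ} (hX : X.IsHermitian) (hX0 : trace X = 0) :
    X = !![((X 0 0).re : ℂ), X 0 1; starRingEnd ℂ (X 0 1), -((X 0 0).re : ℂ)] := by
  have h10 : starRingEnd ℂ (X 0 1) = X 1 0 := hX.apply 1 0
  have h00 : starRingEnd ℂ (X 0 0) = X 0 0 := hX.apply 0 0
  have h00' : ((X 0 0).re : ℂ) = X 0 0 := by
    rw [Complex.ext_iff]
    refine ⟨by simp, ?_⟩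
    simp only [Complex.ofReal_im]
    exact ((Complex.conj_eq_iff_im.mp h00)).symm
  have h11 : X 1 1 = -X 0 0 := by
    rw [Matrix.trace_fin_two] at hX0
    linear_combination hX0
  ext i j
  fin_cases i <;> fin_cases j
  · simp [h00']
  · simp
  · simp [h10]
  · simp [h11, h00']

/-- **COMPLETENESS of the Pauli components on su(2)**: `Σ_k (½ tr σ_k X) σ_k = X` for traceless hermitian `X`.
[folklore] -/
theorem pauli_complete (X : Matrix (Fin 2) (Fin 2) ℂ) (hX : X.IsHermitian) (hX0 : trace X = 0) :
    ∑ k, form (1 / 2 : ℝ) (pauli k) X • pauli k = X := by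
  rw [eq_param_of_herm0 hX hX0]
  exact pauli_complete' _ _

/-- **`hRm` HYPOTHESIS-FREE for SU(2)/U(2) backgrounds in the Pauli components.**
[cite: Balaban1985BackgroundPropagators, p.390 + p.392] -/
theorem hRm_pauli {Bd : Type*} (U : Bd → Matrix (Fin 2) (Fin 2) ℂ) (hU : ∀ b, U b ∈ Matrix.unitaryGroup (Fin 2) ℂ) :
    ∀ b i j, ∑ k, compMat (1 / 2 : ℝ) pauli U b k i * compMat (1 / 2 : ℝ) pauli U b k j =
      if i = j then 1 else 0 :=
  compMat_orthogonal_herm0 (1 / 2 : ℝ) pauli (fun k => ⟨pauli_isHermitian k, pauli_trace k⟩) pauli_orth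
    pauli_complete U hU

/-- `σ₁` is an involution. [folklore] -/
theorem σ₁_mul_σ₁ : σ₁ * σ₁ = 1 := by
  ext i j
  fin_cases i <;> fin_cases j <;> simp [σ₁, Matrix.mul_apply, Fin.sum_univ_two]

/-- `σ₁ ∈ U(2)`. [folklore] -/
theorem σ₁_mem_unitaryGroup : σ₁ ∈ Matrix.unitaryGroup (Fin 2) ℂ := by
  rw [Matrix.mem_unitaryGroup_iff]
  have h : star σ₁ = σ₁ := by
    rw [Matrix.star_eq_conjTranspose]
    exact (pauli_isHermitian 0).eq
  rw [h, σ₁_mul_σ₁]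

/-- THE ROTATION IS NON-TRIVIAL: `R(σ₁)σ₃ = σ₁σ₃σ₁⁻¹ = −σ₃`. [folklore] -/
theorem R_σ₁_σ₃ : R σ₁ σ₃ = -σ₃ := by
  rw [R, Matrix.inv_eq_left_inv σ₁_mul_σ₁]
  ext i j
  fin_cases i <;> fin_cases j <;> simp [σ₁, σ₃, Matrix.mul_apply, Fin.sum_univ_two]

/-- … so the component matrix at a bond carrying `σ₁` has the entry `Rm_{33} = −1 ≠ 1`: the discharged `hRm` is not
the identity instance of `B9Thm37GlueTorus` §6. [folklore] -/
theorem compMat_pauli_σ₁ : compMat (1 / 2 : ℝ) pauli (fun _ : Unit => σ₁) () 2 2 = -1 := by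
  rw [compMat_apply, pauli_two, R_σ₁_σ₃]
  simp [σ₃, Matrix.trace_fin_two]
  norm_num

end Pauli

/-! ## §5 (v1.1, APPEND-ONLY) Existence of trace-orthonormal complete component families — every `N`, every hermitian real subspace -/

section Existence

open scoped ComplexOrder

variable {n : Type*} [Fintype n] [DecidableEq n]

omit [DecidableEq n] in
/-- On a hermitian matrix the trace form is the Hilbert–Schmidt square: `form c X X = c · Re tr X*X`. [folklore] -/
theorem form_self_eq {c : ℝ} {X : Matrix n n ℂ} (hX : X.IsHermitian) :
    form c X X = c * (trace (Xᴴ * X)).re := by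
  rw [form_apply, hX.eq]

omit [DecidableEq n] in
/-- The trace form is nonnegative on hermitian matrices (`c ≥ 0`). [folklore] -/
theorem form_self_nonneg {c : ℝ} (hc : 0 ≤ c) {X : Matrix n n ℂ} (hX : X.IsHermitian) : 0 ≤ form c X X := by
  rw [form_self_eq hX]
  refine mul_nonneg hc ?_
  have h := (Matrix.posSemidef_conjTranspose_mul_self X).trace_nonneg
  exact (Complex.nonneg_iff.mp h).1

omit [DecidableEq n] in
/-- The trace form is DEFINITE on hermitian matrices (`c > 0`): «X·Y = tr XY» is an inner product on 𝔤.
[cite: Balaban1985BackgroundPropagators, p.392] -/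
theorem eq_zero_of_form_self_eq_zero {c : ℝ} (hc : 0 < c) {X : Matrix n n ℂ} (hX : X.IsHermitian)
    (h : form c X X = 0) : X = 0 := by
  rw [form_self_eq hX] at h
  have hre : (trace (Xᴴ * X)).re = 0 := by
    rcases mul_eq_zero.mp h with h | h
    · exact absurd h hc.ne'
    · exact h
  have hnn := (Matrix.posSemidef_conjTranspose_mul_self X).trace_nonneg
  have him : (trace (Xᴴ * X)).im = 0 := (Complex.nonneg_iff.mp hnn).2.symm
  have h0 : trace (Xᴴ * X) = 0 := Complex.ext hre him
  exact Matrix.trace_conjTranspose_mul_self_eq_zero_iff.mp h0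

omit [DecidableEq n] in
/-- **EXISTENCE OF TRACE-ORTHONORMAL COMPLETE COMPONENT FAMILIES.**  For `c > 0` and ANY real subspace `P` of hermitian
matrices (u(N), su(N), the hermitian-convention Lie algebra of any closed `G ⊂ U(N)`, …) there is a finite family
`e : Fin m → P` (`m = dim_ℝ P`) which is `form c`-orthonormal and complete on `P` — so the hypotheses `he`, `horth`,
`hcompl` of `compMat_orthogonal` / `_herm` / `_herm0` are inhabited for every `N` (Gram–Schmidt, via Mathlib's
`stdOrthonormalBasis` for the inner product `form c` on `P`). [folklore] -/
theorem exists_orthonormal_complete {c : ℝ} (hc : 0 < c) (P : Submodule ℝ (Matrix n n ℂ))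
    (hP : ∀ X ∈ P, X.IsHermitian) :
    ∃ (m : ℕ) (e : Fin m → Matrix n n ℂ), (∀ k, e k ∈ P) ∧
      (∀ k l, form c (e k) (e l) = if k = l then 1 else 0) ∧ (∀ X ∈ P, ∑ k, form c (e k) X • e k = X) := by
  classical
  letI core : InnerProductSpace.Core ℝ P :=
    { inner := fun x y => form c (x : Matrix n n ℂ) (y : Matrix n n ℂ)
      conj_inner_symm := fun x y => by
        simp only [conj_trivial]
        exact form_comm c _ _
      re_inner_nonneg := fun x => by
        simp only [RCLike.re_to_real]
        exact form_self_nonneg hc.le (hP _ x.2)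
      add_left := fun x y z => by
        simp only [Submodule.coe_add, map_add, LinearMap.add_apply]
      smul_left := fun x y r => by
        simp only [Submodule.coe_smul, map_smul, LinearMap.smul_apply, smul_eq_mul, conj_trivial]
      definite := fun x hx => by
        have h := eq_zero_of_form_self_eq_zero hc (hP _ x.2) hx
        exact Subtype.ext h }
  letI : NormedAddCommGroup P := InnerProductSpace.Core.toNormedAddCommGroup (𝕜 := ℝ) (cd := core)
  letI : InnerProductSpace ℝ P := InnerProductSpace.ofCore core.toCore
  let b := stdOrthonormalBasis ℝ P
  refine ⟨Module.finrank ℝ P, fun k => (b k : Matrix n n ℂ), fun k => (b k).2, fun k l => ?_, fun X hX => ?_⟩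
  · have h := orthonormal_iff_ite.mp b.orthonormal k l
    exact h
  · have h := congrArg Subtype.val (b.sum_repr' ⟨X, hX⟩)
    simp only [AddSubmonoidClass.coe_finsetSum, Submodule.coe_smul_of_tower] at h
    exact h

/-- **u(N): the hypotheses of `compMat_orthogonal_herm` are inhabited for every `N`**, hence `hRm` holds for some
trace-orthonormal complete hermitian component family and EVERY unitary background.
[cite: Balaban1985BackgroundPropagators, p.390 + p.392] -/
theorem exists_hRm_herm {Bd : Type*} {c : ℝ} (hc : 0 < c) (U : Bd → Matrix n n ℂ)
    (hU : ∀ b, U b ∈ Matrix.unitaryGroup n ℂ) :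
    ∃ (m : ℕ) (e : Fin m → Matrix n n ℂ), (∀ k, (e k).IsHermitian) ∧
      (∀ k l, form c (e k) (e l) = if k = l then 1 else 0) ∧
      (∀ X : Matrix n n ℂ, X.IsHermitian → ∑ k, form c (e k) X • e k = X) ∧
      ∀ b i j, ∑ k, compMat c e U b k i * compMat c e U b k j = if i = j then 1 else 0 := by
  obtain ⟨m, e, he, horth, hcompl⟩ := exists_orthonormal_complete hc (herm n) fun X hX => hX
  exact ⟨m, e, he, horth, fun X hX => hcompl X hX, compMat_orthogonal_herm c e he horth (fun X hX => hcompl X hX) U hU⟩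

/-- **su(N): the hypotheses of `compMat_orthogonal_herm0` are inhabited for every `N`.**
[cite: Balaban1985BackgroundPropagators, p.390 + p.392] -/
theorem exists_hRm_herm0 {Bd : Type*} {c : ℝ} (hc : 0 < c) (U : Bd → Matrix n n ℂ)
    (hU : ∀ b, U b ∈ Matrix.unitaryGroup n ℂ) :
    ∃ (m : ℕ) (e : Fin m → Matrix n n ℂ), (∀ k, (e k).IsHermitian ∧ trace (e k) = 0) ∧
      (∀ k l, form c (e k) (e l) = if k = l then 1 else 0) ∧
      (∀ X : Matrix n n ℂ, X.IsHermitian → trace X = 0 → ∑ k, form c (e k) X • e k = X) ∧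
      ∀ b i j, ∑ k, compMat c e U b k i * compMat c e U b k j = if i = j then 1 else 0 := by
  obtain ⟨m, e, he, horth, hcompl⟩ := exists_orthonormal_complete hc (herm0 n) fun X hX => hX.1
  exact ⟨m, e, he, horth, fun X hX hX0 => hcompl X ⟨hX, hX0⟩,
    compMat_orthogonal_herm0 c e he horth (fun X hX hX0 => hcompl X ⟨hX, hX0⟩) U hU⟩

end Existence

/-! ## §6 (v1.2, APPEND-ONLY + one import) The component count: `dim_ℝ u(N) = N²`, `dim_ℝ su(N) = N² − 1`, and `hRm` with the index type pinned -/

section Dimension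

open Module
open Literature.MathematicalPhysics.QuantumLattice (selfAdjointEquivSkewAdjoint finrank_skewAdjoint_submodule
  finrank_skewAdjoint_inf_ker_trace)

variable {n : Type*} [Fintype n]

omit [Fintype n] in
/-- `herm n` IS Mathlib's self-adjoint real submodule of `M_N(ℂ)` («functions with values in N × N hermitian
matrices», p. 391). [folklore] -/
theorem herm_eq_selfAdjoint : herm n = selfAdjoint.submodule ℝ (Matrix n n ℂ) :=
  SetLike.ext fun _ => Iff.rfl

/-- **`dim_ℝ u(N) = N²`**: the real dimension of the hermitian `N × N` matrices is `(card n)²` (tree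
`RepLieAlgebraUnitary`: `M_N(ℂ) = Herm ⊕ skew-Herm`, `Herm ≅ skew-Herm` by `X ↦ iX`, Bröcker–tom Dieck I (2.16)).
[folklore] -/
theorem finrank_herm : finrank ℝ (herm n) = Fintype.card n ^ 2 := by
  classical
  rw [LinearEquiv.finrank_eq ((LinearEquiv.ofEq _ _ herm_eq_selfAdjoint).trans selfAdjointEquivSkewAdjoint)]
  exact finrank_skewAdjoint_submodule

/-- Every real subspace of hermitian matrices (the hermitian-convention Lie algebra 𝔤 of any `G ⊂ U(N)`) has real
dimension at most `N²`. [folklore] -/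
theorem finrank_le_of_herm (P : Submodule ℝ (Matrix n n ℂ)) (hP : ∀ X ∈ P, X.IsHermitian) :
    finrank ℝ P ≤ Fintype.card n ^ 2 := by
  rw [← finrank_herm (n := n)]
  exact Submodule.finrank_mono fun X hX => hP X hX

/-- **`herm0 n ≅ 𝔰𝔲(n) = 𝔲(n) ⊓ ker tr`** as real vector spaces, `X ↦ iX` (inverse `Y ↦ −iY`). [folklore] -/
def herm0EquivSu :
    herm0 n ≃ₗ[ℝ] ↥(skewAdjoint.submodule ℝ (Matrix n n ℂ) ⊓ LinearMap.ker (Matrix.traceLinearMap n ℝ ℂ)) where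
  toFun X := ⟨Complex.I • (X : Matrix n n ℂ), by
    obtain ⟨hX, hX0⟩ := (mem_herm0.mp X.2)
    refine Submodule.mem_inf.2 ⟨?_, ?_⟩
    · show star (Complex.I • (X : Matrix n n ℂ)) = -(Complex.I • (X : Matrix n n ℂ))
      rw [star_smul, Complex.star_def, Complex.conj_I, Matrix.star_eq_conjTranspose, hX.eq, neg_smul]
    · rw [LinearMap.mem_ker, Matrix.traceLinearMap_apply, Matrix.trace_smul, hX0, smul_zero]⟩
  map_add' X Y := by
    ext1
    simp [smul_add]
  map_smul' t X := by
    ext1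
    dsimp
    rw [smul_comm]
  invFun Y := ⟨-Complex.I • (Y : Matrix n n ℂ), by
    obtain ⟨hY, hY0⟩ := Submodule.mem_inf.1 Y.2
    have hY' : star (Y : Matrix n n ℂ) = -Y := hY
    rw [LinearMap.mem_ker, Matrix.traceLinearMap_apply] at hY0
    refine mem_herm0.mpr ⟨?_, ?_⟩
    · show (-Complex.I • (Y : Matrix n n ℂ))ᴴ = -Complex.I • (Y : Matrix n n ℂ)
      rw [Matrix.conjTranspose_smul, ← Matrix.star_eq_conjTranspose, hY', star_neg, Complex.star_def,
        Complex.conj_I, neg_neg, smul_neg, neg_smul]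
    · rw [Matrix.trace_smul, hY0, smul_zero]⟩
  left_inv X := by
    ext1
    simp [smul_smul]
  right_inv Y := by
    ext1
    simp [smul_smul]

/-- `herm0EquivSu` is multiplication by `i`. [folklore] -/
@[simp] theorem coe_herm0EquivSu (X : herm0 n) :
    ((herm0EquivSu X : ↥(skewAdjoint.submodule ℝ (Matrix n n ℂ) ⊓ LinearMap.ker (Matrix.traceLinearMap n ℝ ℂ))) :
      Matrix n n ℂ) = Complex.I • (X : Matrix n n ℂ) := rfl

/-- **`dim_ℝ su(N) = N² − 1`**: the real dimension of the traceless hermitian `N × N` matrices is `(card n)² − 1`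
(tree `RepLieAlgebraUnitary.finrank_skewAdjoint_inf_ker_trace`, Bröcker–tom Dieck I (2.16), (2.18); both sides `0`
for empty `n`). [folklore] -/
theorem finrank_herm0 : finrank ℝ (herm0 n) = Fintype.card n ^ 2 - 1 := by
  classical
  rw [LinearEquiv.finrank_eq (herm0EquivSu (n := n))]
  exact finrank_skewAdjoint_inf_ker_trace

/-- **GRAM–SCHMIDT WITH THE INDEX TYPE PINNED**: for `c > 0` every real subspace `P` of hermitian matrices carries a
`form c`-orthonormal complete family indexed by `Fin (dim_ℝ P)` (v1.1's `exists_orthonormal_complete` with the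
number of components named). [folklore] -/
theorem exists_orthonormal_complete_finrank {c : ℝ} (hc : 0 < c) (P : Submodule ℝ (Matrix n n ℂ))
    (hP : ∀ X ∈ P, X.IsHermitian) :
    ∃ e : Fin (finrank ℝ P) → Matrix n n ℂ, (∀ k, e k ∈ P) ∧
      (∀ k l, form c (e k) (e l) = if k = l then 1 else 0) ∧ (∀ X ∈ P, ∑ k, form c (e k) X • e k = X) := by
  classical
  letI core : InnerProductSpace.Core ℝ P :=
    { inner := fun x y => form c (x : Matrix n n ℂ) (y : Matrix n n ℂ)
      conj_inner_symm := fun x y => by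
        simp only [conj_trivial]
        exact form_comm c _ _
      re_inner_nonneg := fun x => by
        simp only [RCLike.re_to_real]
        exact form_self_nonneg hc.le (hP _ x.2)
      add_left := fun x y z => by
        simp only [Submodule.coe_add, map_add, LinearMap.add_apply]
      smul_left := fun x y r => by
        simp only [Submodule.coe_smul, map_smul, LinearMap.smul_apply, smul_eq_mul, conj_trivial]
      definite := fun x hx => by
        have h := eq_zero_of_form_self_eq_zero hc (hP _ x.2) hx
        exact Subtype.ext h }
  letI : NormedAddCommGroup P := InnerProductSpace.Core.toNormedAddCommGroup (𝕜 := ℝ) (cd := core)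
  letI : InnerProductSpace ℝ P := InnerProductSpace.ofCore core.toCore
  let b := stdOrthonormalBasis ℝ P
  refine ⟨fun k => (b k : Matrix n n ℂ), fun k => (b k).2, fun k l => ?_, fun X hX => ?_⟩
  · have h := orthonormal_iff_ite.mp b.orthonormal k l
    exact h
  · have h := congrArg Subtype.val (b.sum_repr' ⟨X, hX⟩)
    simp only [AddSubmonoidClass.coe_finsetSum, Submodule.coe_smul_of_tower] at h
    exact h

/-- THE MODEL PREFACTOR AS A FUNCTION OF `(d, N)`: with `Cp = Fin (N² − 1)` (su(N) components, `N ≥ 1`) the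
prefactor `d + d · card Cp` of `B9Thm37GlueTorus.thm37_entry4_l1(_diag)` equals `d · N²` (arithmetic; no statement
of the Glue files is imported or altered). [folklore] -/
theorem glue_prefactor_suN (d : ℝ) {N : ℕ} (hN : 1 ≤ N) :
    d + d * (Fintype.card (Fin (N ^ 2 - 1)) : ℝ) = d * (N : ℝ) ^ 2 := by
  rw [Fintype.card_fin]
  have h1 : 1 ≤ N ^ 2 := Nat.one_le_pow _ _ hN
  rw [Nat.cast_sub h1, Nat.cast_pow, Nat.cast_one]
  ring

/-- … and with `Cp = Fin (N²)` (u(N) components) it equals `d · (N² + 1)`. [folklore] -/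
theorem glue_prefactor_uN (d : ℝ) (N : ℕ) :
    d + d * (Fintype.card (Fin (N ^ 2)) : ℝ) = d * ((N : ℝ) ^ 2 + 1) := by
  rw [Fintype.card_fin, Nat.cast_pow]
  ring

/-- For a GENERAL hermitian-convention Lie algebra `𝔤 = P ⊆ herm` (any closed `G ⊂ U(N)`), the pinned component
count is `dim_ℝ P ≤ N²`, so the same prefactor is at most `d · (N² + 1)` for `d ≥ 0`. [folklore] -/
theorem glue_prefactor_le (d : ℝ) (hd : 0 ≤ d) (P : Submodule ℝ (Matrix n n ℂ)) (hP : ∀ X ∈ P, X.IsHermitian) :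
    d + d * (Fintype.card (Fin (finrank ℝ P)) : ℝ) ≤ d * ((Fintype.card n : ℝ) ^ 2 + 1) := by
  rw [Fintype.card_fin]
  have h : (finrank ℝ P : ℝ) ≤ (Fintype.card n : ℝ) ^ 2 := by
    exact_mod_cast finrank_le_of_herm P hP
  nlinarith

end Dimension

/-! ### `hRm` with the component index type pinned: `Cp = Fin (N²)` (u(N)), `Cp = Fin (N² − 1)` (su(N)) -/

section PinnedIndex

variable {n : Type*} [Fintype n] [DecidableEq n]

/-- TRANSPORT of a component family along an equality of index cardinalities `m = K` (pure reindexing: membership,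
trace-orthonormality, completeness and `hRm` are statements about the family, not about the name of its index
type). [folklore] -/
theorem family_transport {Bd : Type*} {m K : ℕ} (hK : m = K) (c : ℝ) (U : Bd → Matrix n n ℂ)
    (S : Set (Matrix n n ℂ)) (e : Fin m → Matrix n n ℂ)
    (h : (∀ k, e k ∈ S) ∧ (∀ k l, form c (e k) (e l) = if k = l then 1 else 0) ∧
      (∀ X ∈ S, ∑ k, form c (e k) X • e k = X) ∧
      ∀ b i j, ∑ k, compMat c e U b k i * compMat c e U b k j = if i = j then 1 else 0) :
    ∃ e' : Fin K → Matrix n n ℂ, (∀ k, e' k ∈ S) ∧ (∀ k l, form c (e' k) (e' l) = if k = l then 1 else 0) ∧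
      (∀ X ∈ S, ∑ k, form c (e' k) X • e' k = X) ∧
      ∀ b i j, ∑ k, compMat c e' U b k i * compMat c e' U b k j = if i = j then 1 else 0 := by
  subst hK
  exact ⟨e, h⟩

/-- **u(N) WITH `N²` COMPONENTS**: a trace-orthonormal complete HERMITIAN family indexed by `Fin ((card n)²)`, hence
`hRm` for EVERY unitary background with the component type `Cp = Fin (N²)` (`Fintype.card Cp = N²`).
[cite: Balaban1985BackgroundPropagators, p.390 + p.392] -/
theorem exists_hRm_herm_sq {Bd : Type*} {c : ℝ} (hc : 0 < c) (U : Bd → Matrix n n ℂ)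
    (hU : ∀ b, U b ∈ Matrix.unitaryGroup n ℂ) :
    ∃ e : Fin (Fintype.card n ^ 2) → Matrix n n ℂ, (∀ k, (e k).IsHermitian) ∧
      (∀ k l, form c (e k) (e l) = if k = l then 1 else 0) ∧
      (∀ X : Matrix n n ℂ, X.IsHermitian → ∑ k, form c (e k) X • e k = X) ∧
      ∀ b i j, ∑ k, compMat c e U b k i * compMat c e U b k j = if i = j then 1 else 0 := by
  obtain ⟨e, he, horth, hcompl⟩ := exists_orthonormal_complete_finrank hc (herm n) fun X hX => hX
  exact family_transport finrank_herm c U {X | X.IsHermitian} e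
    ⟨he, horth, fun X hX => hcompl X hX, compMat_orthogonal_herm c e he horth (fun X hX => hcompl X hX) U hU⟩

/-- **su(N) WITH `N² − 1` COMPONENTS**: a trace-orthonormal complete TRACELESS HERMITIAN family indexed by
`Fin ((card n)² − 1)`, hence `hRm` for EVERY unitary background with the component type `Cp = Fin (N² − 1)`
(`Fintype.card Cp = N² − 1 = dim su(N)`). [cite: Balaban1985BackgroundPropagators, p.390 + p.392] -/
theorem exists_hRm_herm0_sq {Bd : Type*} {c : ℝ} (hc : 0 < c) (U : Bd → Matrix n n ℂ)
    (hU : ∀ b, U b ∈ Matrix.unitaryGroup n ℂ) :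
    ∃ e : Fin (Fintype.card n ^ 2 - 1) → Matrix n n ℂ, (∀ k, (e k).IsHermitian ∧ trace (e k) = 0) ∧
      (∀ k l, form c (e k) (e l) = if k = l then 1 else 0) ∧
      (∀ X : Matrix n n ℂ, X.IsHermitian → trace X = 0 → ∑ k, form c (e k) X • e k = X) ∧
      ∀ b i j, ∑ k, compMat c e U b k i * compMat c e U b k j = if i = j then 1 else 0 := by
  obtain ⟨e, he, horth, hcompl⟩ := exists_orthonormal_complete_finrank hc (herm0 n) fun X hX => hX.1
  obtain ⟨e', h1, h2, h3, h4⟩ := family_transport finrank_herm0 c U {X | X.IsHermitian ∧ trace X = 0} e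
    ⟨he, horth, fun X hX => hcompl X hX,
      compMat_orthogonal_herm0 c e he horth (fun X hX hX0 => hcompl X ⟨hX, hX0⟩) U hU⟩
  exact ⟨e', h1, h2, fun X hX hX0 => h3 X ⟨hX, hX0⟩, h4⟩

/-- **`G = U(N)` on `Fin N`: `hRm` with exactly `N²` hermitian components.**
[cite: Balaban1985BackgroundPropagators, p.390 + p.392] -/
theorem exists_hRm_uN (N : ℕ) {Bd : Type*} {c : ℝ} (hc : 0 < c) (U : Bd → Matrix (Fin N) (Fin N) ℂ)
    (hU : ∀ b, U b ∈ Matrix.unitaryGroup (Fin N) ℂ) :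
    ∃ e : Fin (N ^ 2) → Matrix (Fin N) (Fin N) ℂ, (∀ k, (e k).IsHermitian) ∧
      (∀ k l, form c (e k) (e l) = if k = l then 1 else 0) ∧
      (∀ X : Matrix (Fin N) (Fin N) ℂ, X.IsHermitian → ∑ k, form c (e k) X • e k = X) ∧
      ∀ b i j, ∑ k, compMat c e U b k i * compMat c e U b k j = if i = j then 1 else 0 := by
  obtain ⟨e, h⟩ := exists_hRm_herm_sq hc U hU
  exact family_transport (by rw [Fintype.card_fin]) c U {X | X.IsHermitian} e h

/-- **`G = SU(N)` on `Fin N`: `hRm` with exactly `N² − 1 = dim su(N)` traceless hermitian components** — the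
`Fintype.card Cp` entering the constants `(d + d · card Cp)` of `B9Thm37GlueTorus.thm37_entry4_l1(_diag)` is then
`N² − 1`, a function of `N` alone. [cite: Balaban1985BackgroundPropagators, p.390 + p.392] -/
theorem exists_hRm_suN (N : ℕ) {Bd : Type*} {c : ℝ} (hc : 0 < c) (U : Bd → Matrix (Fin N) (Fin N) ℂ)
    (hU : ∀ b, U b ∈ Matrix.unitaryGroup (Fin N) ℂ) :
    ∃ e : Fin (N ^ 2 - 1) → Matrix (Fin N) (Fin N) ℂ, (∀ k, (e k).IsHermitian ∧ trace (e k) = 0) ∧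
      (∀ k l, form c (e k) (e l) = if k = l then 1 else 0) ∧
      (∀ X : Matrix (Fin N) (Fin N) ℂ, X.IsHermitian → trace X = 0 → ∑ k, form c (e k) X • e k = X) ∧
      ∀ b i j, ∑ k, compMat c e U b k i * compMat c e U b k j = if i = j then 1 else 0 := by
  obtain ⟨e, h1, h2, h3, h4⟩ := exists_hRm_herm0_sq hc U hU
  obtain ⟨e', h1', h2', h3', h4'⟩ := family_transport (by rw [Fintype.card_fin]) c U
    {X | X.IsHermitian ∧ trace X = 0} e ⟨h1, h2, fun X hX => h3 X hX.1 hX.2, h4⟩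
  exact ⟨e', h1', h2', fun X hX hX0 => h3' X ⟨hX, hX0⟩, h4'⟩

end PinnedIndex

/-! ## §7 (v1.3, APPEND-ONLY) EXPLICIT trace-orthonormal complete families for EVERY `N`: the generalized Gell-Mann components of su(N) and u(N) -/

section OrthonormalComplete

open Module

variable {M : Type*} [AddCommGroup M] [Module ℝ M] {ι : Type*} [Fintype ι] [DecidableEq ι]

/-- A family orthonormal for a real bilinear form is linearly independent (apply `φ(e_k, ·)` to a vanishing
combination). [folklore] -/
theorem linearIndependent_of_form_orthonormal (φ : M →ₗ[ℝ] M →ₗ[ℝ] ℝ) (e : ι → M)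
    (horth : ∀ k l, φ (e k) (e l) = if k = l then 1 else 0) : LinearIndependent ℝ e := by
  classical
  rw [Fintype.linearIndependent_iff]
  intro g hg k
  have h := congrArg (fun X => φ (e k) X) hg
  simp only [map_sum, map_smul, smul_eq_mul, map_zero, horth, mul_ite, mul_one, mul_zero,
    Finset.sum_ite_eq, Finset.mem_univ, if_true] at h
  exact h

/-- **ORTHONORMAL + FULL CARDINALITY ⇒ COMPLETE.**  A `φ`-orthonormal family lying in a finite-dimensional real
subspace `P` and having exactly `dim_ℝ P` members is complete on `P`: `Σ_k φ(e_k, X) e_k = X` for every `X ∈ P`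
(orthonormal ⇒ independent ⇒ basis by the cardinality; the coordinates in an orthonormal basis are the `φ(e_k, X)`).
[folklore] -/
theorem complete_of_form_orthonormal_card_eq (φ : M →ₗ[ℝ] M →ₗ[ℝ] ℝ) (P : Submodule ℝ M)
    [FiniteDimensional ℝ P] (e : ι → M) (he : ∀ k, e k ∈ P)
    (horth : ∀ k l, φ (e k) (e l) = if k = l then 1 else 0) (hcard : Fintype.card ι = finrank ℝ P) :
    ∀ X ∈ P, ∑ k, φ (e k) X • e k = X := by
  classical
  let e' : ι → P := fun k => ⟨e k, he k⟩
  have he' : (P.subtype ∘ e') = e := rfl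
  have hli : LinearIndependent ℝ e' := by
    have h := linearIndependent_of_form_orthonormal φ e horth
    rw [← he'] at h
    exact LinearIndependent.of_comp _ h
  let b : Basis ι ℝ P := basisOfLinearIndependentOfCardEqFinrank' e' hli hcard
  have hb : ∀ k, ((b k : P) : M) = e k := fun k => by
    simp only [b, coe_basisOfLinearIndependentOfCardEqFinrank', e']
  intro X hX
  have hrepr : ∑ k, b.repr ⟨X, hX⟩ k • b k = ⟨X, hX⟩ := b.sum_repr ⟨X, hX⟩
  have hreprM : ∑ k, b.repr ⟨X, hX⟩ k • e k = X := by
    have h := congrArg Subtype.val hrepr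
    simpa only [AddSubmonoidClass.coe_finsetSum, Submodule.coe_smul_of_tower, hb] using h
  have hcoef : ∀ k, φ (e k) X = b.repr ⟨X, hX⟩ k := by
    intro k
    conv_lhs => rw [← hreprM]
    simp only [map_sum, map_smul, smul_eq_mul, horth, mul_ite, mul_one, mul_zero, Finset.sum_ite_eq,
      Finset.mem_univ, if_true]
  simp only [hcoef]
  exact hreprM

end OrthonormalComplete

/-! ### Reindexing and rescaling a component family -/

section Reindex

variable {n : Type*} [Fintype n] {ι κ : Type*}

/-- Bilinearity of the trace form under real rescaling of both arguments. [folklore] -/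
theorem form_smul_smul (c r s : ℝ) (X Y : Matrix n n ℂ) : form c (r • X) (s • Y) = r * s * form c X Y := by
  simp only [map_smul, LinearMap.smul_apply, smul_eq_mul]
  ring

/-- RESCALING `c ↦ 1`: `form c` on the family `(√c)⁻¹ • e` is `form 1` on `e` (`c > 0`; the print's `c = 1/N`).
[folklore] -/
theorem form_rescale {c : ℝ} (hc : 0 < c) (X Y : Matrix n n ℂ) :
    form c ((Real.sqrt c)⁻¹ • X) ((Real.sqrt c)⁻¹ • Y) = form 1 X Y := by
  have key : (Real.sqrt c)⁻¹ * (Real.sqrt c)⁻¹ * c = 1 := by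
    rw [← mul_inv, Real.mul_self_sqrt hc.le, inv_mul_cancel₀ hc.ne']
  rw [form_smul_smul, form_apply, form_apply, one_mul, ← mul_assoc, key, one_mul]

/-- The completeness summand is rescaling-invariant: `(e·X)_c (√c)⁻¹e = (e·X)_1 e` with `e ↦ (√c)⁻¹ e` on the left.
[folklore] -/
theorem rescale_term {c : ℝ} (hc : 0 < c) (E X : Matrix n n ℂ) :
    form c ((Real.sqrt c)⁻¹ • E) X • ((Real.sqrt c)⁻¹ • E) = form 1 E X • E := by
  have key : (Real.sqrt c)⁻¹ * (Real.sqrt c)⁻¹ * c = 1 := by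
    rw [← mul_inv, Real.mul_self_sqrt hc.le, inv_mul_cancel₀ hc.ne']
  rw [map_smul, LinearMap.smul_apply, smul_eq_mul, smul_smul, form_apply, form_apply, one_mul]
  congr 1
  calc (Real.sqrt c)⁻¹ * (c * (trace (E * X)).re) * (Real.sqrt c)⁻¹
      = (Real.sqrt c)⁻¹ * (Real.sqrt c)⁻¹ * c * (trace (E * X)).re := by ring
    _ = (trace (E * X)).re := by rw [key, one_mul]

/-- Trace-orthonormality for `form 1` of `e` ⇒ trace-orthonormality for `form c` of `(√c)⁻¹ • e`. [folklore] -/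
theorem orth_rescale [DecidableEq ι] {c : ℝ} (hc : 0 < c) (e : ι → Matrix n n ℂ)
    (horth : ∀ k l, form 1 (e k) (e l) = if k = l then 1 else 0) :
    ∀ k l, form c ((Real.sqrt c)⁻¹ • e k) ((Real.sqrt c)⁻¹ • e l) = if k = l then 1 else 0 := fun k l => by
  rw [form_rescale hc, horth]

/-- Completeness for `form 1` of `e` ⇒ completeness for `form c` of `(√c)⁻¹ • e`. [folklore] -/
theorem complete_rescale [Fintype ι] {c : ℝ} (hc : 0 < c) (e : ι → Matrix n n ℂ) (S : Set (Matrix n n ℂ))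
    (hcompl : ∀ X ∈ S, ∑ k, form 1 (e k) X • e k = X) :
    ∀ X ∈ S, ∑ k, form c ((Real.sqrt c)⁻¹ • e k) X • ((Real.sqrt c)⁻¹ • e k) = X := fun X hX => by
  simp only [rescale_term hc]
  exact hcompl X hX

/-- Trace-orthonormality is invariant under reindexing along an equivalence of index types. [folklore] -/
theorem orth_reindex [DecidableEq ι] [DecidableEq κ] (c : ℝ) (e : ι → Matrix n n ℂ) (ε : κ ≃ ι)
    (horth : ∀ k l, form c (e k) (e l) = if k = l then 1 else 0) :
    ∀ k l, form c (e (ε k)) (e (ε l)) = if k = l then 1 else 0 := by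
  intro k l
  rw [horth]
  simp only [EmbeddingLike.apply_eq_iff_eq]

/-- Completeness on a set is invariant under reindexing along an equivalence of index types. [folklore] -/
theorem complete_reindex [Fintype ι] [Fintype κ] (c : ℝ) (e : ι → Matrix n n ℂ) (ε : κ ≃ ι)
    (S : Set (Matrix n n ℂ)) (hcompl : ∀ X ∈ S, ∑ k, form c (e k) X • e k = X) :
    ∀ X ∈ S, ∑ k, form c (e (ε k)) X • e (ε k) = X := by
  intro X hX
  rw [ε.sum_comp (fun k => form c (e k) X • e k)]
  exact hcompl X hX

end Reindex

/-! ### The generalized Gell-Mann matrices -/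

section GellMann

/-- THE DIAGONAL COEFFICIENT PATTERN of the `l`-th diagonal generator as a function of the row number `i`:
`(1, …, 1, −(l+1), 0, …, 0)` with `l + 1` ones. [folklore] -/
def dcoef (l i : ℕ) : ℝ := if i ≤ l then 1 else if i = l + 1 then -((l : ℝ) + 1) else 0

/-- MASTER SUM: `Σ_{i<K} dcoef l i · g i = Σ_{i≤l} g i − (l+1) g (l+1)` once `l + 2 ≤ K`. [folklore] -/
theorem sum_range_dcoef_mul {l K : ℕ} (h : l + 2 ≤ K) (g : ℕ → ℝ) :
    ∑ i ∈ Finset.range K, dcoef l i * g i =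
      (∑ i ∈ Finset.range (l + 1), g i) - ((l : ℝ) + 1) * g (l + 1) := by
  obtain ⟨r, rfl⟩ : ∃ r, K = l + 1 + 1 + r := ⟨K - (l + 2), by omega⟩
  rw [Finset.sum_range_add, Finset.sum_range_succ, Finset.sum_eq_zero (s := Finset.range r), add_zero]
  · have h1 : ∑ i ∈ Finset.range (l + 1), dcoef l i * g i = ∑ i ∈ Finset.range (l + 1), g i :=
      Finset.sum_congr rfl fun i hi => by
        rw [Finset.mem_range] at hi
        rw [dcoef, if_pos (by omega), one_mul]
    rw [h1, dcoef, if_neg (by omega), if_pos rfl]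
    ring
  · intro i _
    rw [dcoef, if_neg (by omega), if_neg (by omega), zero_mul]

/-- `Σ_{i<K} dcoef l i = 0` (the diagonal generators are traceless). [folklore] -/
theorem sum_range_dcoef {l K : ℕ} (h : l + 2 ≤ K) : ∑ i ∈ Finset.range K, dcoef l i = 0 := by
  have h1 := sum_range_dcoef_mul h fun _ => 1
  simp only [mul_one, Finset.sum_const, Finset.card_range, nsmul_eq_mul, Nat.cast_add, Nat.cast_one] at h1
  rw [h1]
  ring

/-- `Σ_{i<K} dcoef l i · dcoef m i = 0` for `l < m` (distinct diagonal generators are trace-orthogonal). [folklore] -/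
theorem sum_range_dcoef_mul_dcoef_of_lt {l m K : ℕ} (hlm : l < m) (h : m + 2 ≤ K) :
    ∑ i ∈ Finset.range K, dcoef l i * dcoef m i = 0 := by
  rw [sum_range_dcoef_mul (by omega) (dcoef m)]
  have h1 : ∑ i ∈ Finset.range (l + 1), dcoef m i = ∑ i ∈ Finset.range (l + 1), (1 : ℝ) :=
    Finset.sum_congr rfl fun i hi => by
      rw [Finset.mem_range] at hi
      rw [dcoef, if_pos (by omega)]
  rw [h1, Finset.sum_const, Finset.card_range, nsmul_eq_mul, mul_one, dcoef, if_pos (by omega)]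
  push_cast
  ring

/-- … and for `l ≠ m`. [folklore] -/
theorem sum_range_dcoef_mul_dcoef_of_ne {l m K : ℕ} (hlm : l ≠ m) (hl : l + 2 ≤ K) (hm : m + 2 ≤ K) :
    ∑ i ∈ Finset.range K, dcoef l i * dcoef m i = 0 := by
  rcases lt_or_gt_of_ne hlm with h | h
  · exact sum_range_dcoef_mul_dcoef_of_lt h hm
  · rw [Finset.sum_congr rfl fun i _ => mul_comm (dcoef l i) (dcoef m i)]
    exact sum_range_dcoef_mul_dcoef_of_lt h hl

/-- `Σ_{i<K} (dcoef l i)² = (l+1)(l+2)` (the squared trace norm of the `l`-th diagonal generator). [folklore] -/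
theorem sum_range_dcoef_mul_self {l K : ℕ} (h : l + 2 ≤ K) :
    ∑ i ∈ Finset.range K, dcoef l i * dcoef l i = ((l : ℝ) + 1) * ((l : ℝ) + 2) := by
  rw [sum_range_dcoef_mul h (dcoef l)]
  have h1 : ∑ i ∈ Finset.range (l + 1), dcoef l i = ∑ i ∈ Finset.range (l + 1), (1 : ℝ) :=
    Finset.sum_congr rfl fun i hi => by
      rw [Finset.mem_range] at hi
      rw [dcoef, if_pos (by omega)]
  rw [h1, Finset.sum_const, Finset.card_range, nsmul_eq_mul, mul_one, dcoef, if_neg (by omega), if_pos rfl]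
  push_cast
  ring

variable {N : ℕ}

/-- SYMMETRIC off-diagonal generalized Gell-Mann matrix `E_{jk} + E_{kj}` (unnormalised; `σ₁`-type). [folklore] -/
def gmS (j k : Fin N) : Matrix (Fin N) (Fin N) ℂ := single j k 1 + single k j 1

/-- ANTISYMMETRIC off-diagonal generalized Gell-Mann matrix `−i E_{jk} + i E_{kj}` (unnormalised; `σ₂`-type).
[folklore] -/
def gmA (j k : Fin N) : Matrix (Fin N) (Fin N) ℂ := single j k (-Complex.I) + single k j Complex.I

variable (N) in
/-- DIAGONAL generalized Gell-Mann matrix `diag(1, …, 1, −(l+1), 0, …, 0)` (unnormalised; `σ₃` / `λ₈`-type).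
[folklore] -/
def gmD (l : ℕ) : Matrix (Fin N) (Fin N) ℂ := diagonal fun i : Fin N => ((dcoef l i : ℝ) : ℂ)

/-- Entries of `gmS`. [folklore] -/
theorem gmS_apply (j k a b : Fin N) :
    gmS j k a b = (if j = a ∧ k = b then 1 else 0) + (if k = a ∧ j = b then 1 else 0) := by
  simp only [gmS, Matrix.add_apply, single_apply]

/-- Entries of `gmA`. [folklore] -/
theorem gmA_apply (j k a b : Fin N) :
    gmA j k a b = (if j = a ∧ k = b then -Complex.I else 0) + (if k = a ∧ j = b then Complex.I else 0) := by
  simp only [gmA, Matrix.add_apply, single_apply]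

/-- Entries of `gmD`. [folklore] -/
theorem gmD_apply (l : ℕ) (a b : Fin N) : gmD N l a b = if a = b then ((dcoef l a : ℝ) : ℂ) else 0 := by
  simp only [gmD, diagonal_apply]

/-- Real parts of the entries of `gmS`. [folklore] -/
theorem gmS_apply_re (j k a b : Fin N) :
    (gmS j k a b).re = (if j = a ∧ k = b then 1 else 0) + (if k = a ∧ j = b then 1 else 0) := by
  rw [gmS_apply, Complex.add_re]
  split_ifs <;> simp

/-- The entries of `gmS` are real. [folklore] -/
theorem gmS_apply_im (j k a b : Fin N) : (gmS j k a b).im = 0 := by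
  rw [gmS_apply, Complex.add_im]
  split_ifs <;> simp

/-- The entries of `gmA` are imaginary. [folklore] -/
theorem gmA_apply_re (j k a b : Fin N) : (gmA j k a b).re = 0 := by
  rw [gmA_apply, Complex.add_re]
  split_ifs <;> simp

/-- Imaginary parts of the entries of `gmA`. [folklore] -/
theorem gmA_apply_im (j k a b : Fin N) :
    (gmA j k a b).im = (if j = a ∧ k = b then -1 else 0) + (if k = a ∧ j = b then 1 else 0) := by
  rw [gmA_apply, Complex.add_im]
  split_ifs <;> simp

/-- Diagonal entries of `gmD` (real parts). [folklore] -/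
theorem gmD_apply_same_re (l : ℕ) (a : Fin N) : (gmD N l a a).re = dcoef l a := by
  rw [gmD, diagonal_apply_eq, Complex.ofReal_re]

/-- Off-diagonal entries of `gmD` vanish. [folklore] -/
theorem gmD_apply_of_ne (l : ℕ) {a b : Fin N} (h : a ≠ b) : gmD N l a b = 0 := by
  rw [gmD, diagonal_apply_ne _ h]

/-- The entries of `gmD` are real. [folklore] -/
theorem gmD_apply_im (l : ℕ) (a b : Fin N) : (gmD N l a b).im = 0 := by
  rw [gmD_apply]
  split_ifs <;> simp

/-- `tr (gmS j k · X) = X_{kj} + X_{jk}`. [folklore] -/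
theorem trace_gmS_mul (j k : Fin N) (X : Matrix (Fin N) (Fin N) ℂ) : trace (gmS j k * X) = X k j + X j k := by
  rw [gmS, Matrix.add_mul, trace_add, trace_single_mul, trace_single_mul, one_smul, one_smul]

/-- `tr (gmA j k · X) = −i X_{kj} + i X_{jk}`. [folklore] -/
theorem trace_gmA_mul (j k : Fin N) (X : Matrix (Fin N) (Fin N) ℂ) :
    trace (gmA j k * X) = -Complex.I * X k j + Complex.I * X j k := by
  rw [gmA, Matrix.add_mul, trace_add, trace_single_mul, trace_single_mul, smul_eq_mul, smul_eq_mul]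

/-- `tr (gmD l · X) = Σ_i dcoef l i · X_{ii}`. [folklore] -/
theorem trace_gmD_mul (l : ℕ) (X : Matrix (Fin N) (Fin N) ℂ) :
    trace (gmD N l * X) = ∑ i : Fin N, ((dcoef l i : ℝ) : ℂ) * X i i := by
  simp only [gmD, trace, diag_apply, diagonal_mul]

/-- `gmS j k · X = Re X_{kj} + Re X_{jk}` for the trace form `form 1`. [folklore] -/
theorem form_one_gmS (j k : Fin N) (X : Matrix (Fin N) (Fin N) ℂ) :
    form 1 (gmS j k) X = (X k j).re + (X j k).re := by
  rw [form_apply, trace_gmS_mul, one_mul, Complex.add_re]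

/-- `gmA j k · X = Im X_{kj} − Im X_{jk}` for the trace form `form 1`. [folklore] -/
theorem form_one_gmA (j k : Fin N) (X : Matrix (Fin N) (Fin N) ℂ) :
    form 1 (gmA j k) X = (X k j).im - (X j k).im := by
  rw [form_apply, trace_gmA_mul, one_mul, Complex.add_re, Complex.mul_re, Complex.mul_re, Complex.neg_re,
    Complex.neg_im, Complex.I_re, Complex.I_im]
  ring

/-- `gmD l · X = Σ_i dcoef l i · Re X_{ii}` for the trace form `form 1`. [folklore] -/
theorem form_one_gmD (l : ℕ) (X : Matrix (Fin N) (Fin N) ℂ) :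
    form 1 (gmD N l) X = ∑ i : Fin N, dcoef l i * (X i i).re := by
  rw [form_apply, trace_gmD_mul, one_mul, Complex.re_sum]
  exact Finset.sum_congr rfl fun i _ => Complex.re_ofReal_mul _ _

/-- `gmS j k` is hermitian. [folklore] -/
theorem gmS_isHermitian (j k : Fin N) : (gmS j k).IsHermitian := by
  unfold Matrix.IsHermitian
  rw [gmS, conjTranspose_add, conjTranspose_single, conjTranspose_single, star_one, add_comm]

/-- `gmA j k` is hermitian. [folklore] -/
theorem gmA_isHermitian (j k : Fin N) : (gmA j k).IsHermitian := by
  unfold Matrix.IsHermitian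
  rw [gmA, conjTranspose_add, conjTranspose_single, conjTranspose_single]
  change single k j (starRingEnd ℂ (-Complex.I)) + single j k (starRingEnd ℂ Complex.I) = _
  rw [map_neg, Complex.conj_I, neg_neg, add_comm]

/-- `gmD l` is hermitian. [folklore] -/
theorem gmD_isHermitian (l : ℕ) : (gmD N l).IsHermitian := by
  unfold Matrix.IsHermitian
  rw [gmD, diagonal_conjTranspose]
  congr 1
  funext i
  exact Complex.conj_ofReal _

/-- `gmS j k` is traceless for `j < k`. [folklore] -/
theorem trace_gmS {j k : Fin N} (hjk : j < k) : trace (gmS j k) = 0 := by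
  rw [← Matrix.mul_one (gmS j k), trace_gmS_mul, one_apply_ne hjk.ne', one_apply_ne hjk.ne, add_zero]

/-- `gmA j k` is traceless for `j < k`. [folklore] -/
theorem trace_gmA {j k : Fin N} (hjk : j < k) : trace (gmA j k) = 0 := by
  rw [← Matrix.mul_one (gmA j k), trace_gmA_mul, one_apply_ne hjk.ne', one_apply_ne hjk.ne, mul_zero, mul_zero,
    add_zero]

/-- `gmD l` is traceless once it fits (`l + 2 ≤ N`). [folklore] -/
theorem trace_gmD {l : ℕ} (hl : l + 2 ≤ N) : trace (gmD N l) = 0 := by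
  rw [gmD, trace_diagonal, Fin.sum_univ_eq_sum_range (fun i => ((dcoef l i : ℝ) : ℂ)) N, ← Complex.ofReal_sum,
    sum_range_dcoef hl, Complex.ofReal_zero]

/-- `gmS · gmS`: `2 δ` on index pairs `j < k`. [folklore] -/
theorem form_gmS_gmS {j k j' k' : Fin N} (hjk : j < k) (hjk' : j' < k') :
    form 1 (gmS j k) (gmS j' k') = if j = j' ∧ k = k' then 2 else 0 := by
  rw [form_one_gmS, gmS_apply_re, gmS_apply_re]
  split_ifs <;> (try (exfalso; omega)) <;> norm_num

/-- `gmS · gmA = 0`. [folklore] -/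
theorem form_gmS_gmA (j k j' k' : Fin N) : form 1 (gmS j k) (gmA j' k') = 0 := by
  rw [form_one_gmS, gmA_apply_re, gmA_apply_re, add_zero]

/-- `gmS · gmD = 0` (`j < k`). [folklore] -/
theorem form_gmS_gmD {j k : Fin N} (hjk : j < k) (l : ℕ) : form 1 (gmS j k) (gmD N l) = 0 := by
  rw [form_one_gmS, gmD_apply_of_ne l hjk.ne', gmD_apply_of_ne l hjk.ne, Complex.zero_re, add_zero]

/-- `gmA · gmS = 0`. [folklore] -/
theorem form_gmA_gmS (j k j' k' : Fin N) : form 1 (gmA j k) (gmS j' k') = 0 := by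
  rw [form_one_gmA, gmS_apply_im, gmS_apply_im, sub_zero]

/-- `gmA · gmA`: `2 δ` on index pairs `j < k`. [folklore] -/
theorem form_gmA_gmA {j k j' k' : Fin N} (hjk : j < k) (hjk' : j' < k') :
    form 1 (gmA j k) (gmA j' k') = if j = j' ∧ k = k' then 2 else 0 := by
  rw [form_one_gmA, gmA_apply_im, gmA_apply_im]
  split_ifs <;> (try (exfalso; omega)) <;> norm_num

/-- `gmA · gmD = 0`. [folklore] -/
theorem form_gmA_gmD (j k : Fin N) (l : ℕ) : form 1 (gmA j k) (gmD N l) = 0 := by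
  rw [form_one_gmA, gmD_apply_im, gmD_apply_im, sub_zero]

/-- `gmD l · gmD m = Σ_{i<N} dcoef l i · dcoef m i`. [folklore] -/
theorem form_gmD_gmD (l m : ℕ) : form 1 (gmD N l) (gmD N m) = ∑ i ∈ Finset.range N, dcoef l i * dcoef m i := by
  rw [form_one_gmD]
  simp only [gmD_apply_same_re]
  exact Fin.sum_univ_eq_sum_range (fun i => dcoef l i * dcoef m i) N

/-! ### The index type and the normalised family -/

variable (N) in
/-- THE COMPONENT INDEX TYPE of su(N): a symmetric and an antisymmetric generator per pair `j < k`, and `N − 1`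
diagonal ones. [folklore] -/
abbrev GMIndex : Type :=
  ({p : Fin N × Fin N // p.1 < p.2} ⊕ {p : Fin N × Fin N // p.1 < p.2}) ⊕ Fin (N - 1)

variable (N) in
/-- `2 · #{(j, k) : j < k} = N² − N`. [folklore] -/
theorem two_mul_card_ltPairs : 2 * Fintype.card {p : Fin N × Fin N // p.1 < p.2} = N * N - N := by
  have hswap : Fintype.card {p : Fin N × Fin N // p.2 < p.1} = Fintype.card {p : Fin N × Fin N // p.1 < p.2} :=
    Fintype.card_congr (Equiv.subtypeEquiv (Equiv.prodComm (Fin N) (Fin N)) fun _ => Iff.rfl)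
  have hsum : Fintype.card {p : Fin N × Fin N // p.1 < p.2} + Fintype.card {p : Fin N × Fin N // p.2 < p.1} =
      (Finset.univ : Finset (Fin N)).offDiag.card := by
    rw [Fintype.card_subtype, Fintype.card_subtype, ← Finset.card_union_of_disjoint]
    · congr 1
      ext p
      simp only [Finset.mem_union, Finset.mem_filter, Finset.mem_univ, true_and, Finset.mem_offDiag]
      exact lt_or_lt_iff_ne
    · exact Finset.disjoint_filter.2 fun p _ h1 h2 => lt_asymm h1 h2
  rw [Finset.offDiag_card, Finset.card_univ, Fintype.card_fin] at hsum
  omega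

variable (N) in
/-- **THE COMPONENT COUNT**: `card (GMIndex N) = N² − 1 = dim_ℝ su(N)`. [folklore] -/
theorem card_GMIndex : Fintype.card (GMIndex N) = N ^ 2 - 1 := by
  have h := two_mul_card_ltPairs N
  have hN := Nat.le_mul_self N
  rw [Fintype.card_sum, Fintype.card_sum, Fintype.card_fin, pow_two]
  rcases Nat.eq_zero_or_pos N with rfl | hpos <;> omega

/-- **THE GENERALIZED GELL-MANN COMPONENT FAMILY of su(N)**, normalised for the trace form `form 1` (`tr XY`):
`(E_{jk} + E_{kj})/√2`, `(−iE_{jk} + iE_{kj})/√2` (`j < k`), `diag(1,…,1,−(l+1),0,…,0)/√((l+1)(l+2))`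
(`l < N − 1`); for `N = 2` these are the Pauli matrices `/√2`, for `N = 3` Gell-Mann's `λ_a/√2`. [folklore] -/
def gellMann : GMIndex N → Matrix (Fin N) (Fin N) ℂ
  | Sum.inl (Sum.inl p) => (Real.sqrt 2)⁻¹ • gmS p.1.1 p.1.2
  | Sum.inl (Sum.inr p) => (Real.sqrt 2)⁻¹ • gmA p.1.1 p.1.2
  | Sum.inr l => (Real.sqrt ((((l : ℕ) : ℝ) + 1) * (((l : ℕ) : ℝ) + 2)))⁻¹ • gmD N l

/-- Every generalized Gell-Mann component is TRACELESS HERMITIAN (lies in su(N), hermitian convention). [folklore] -/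
theorem gellMann_mem : ∀ a : GMIndex N, (gellMann a).IsHermitian ∧ trace (gellMann a) = 0 := by
  rintro ((⟨⟨j, k⟩, hjk⟩ | ⟨⟨j, k⟩, hjk⟩) | l)
  · exact ⟨(gmS_isHermitian j k).smul (IsSelfAdjoint.all _), by rw [gellMann, trace_smul, trace_gmS hjk, smul_zero]⟩
  · exact ⟨(gmA_isHermitian j k).smul (IsSelfAdjoint.all _), by rw [gellMann, trace_smul, trace_gmA hjk, smul_zero]⟩
  · exact ⟨(gmD_isHermitian _).smul (IsSelfAdjoint.all _), by
      rw [gellMann, trace_smul, trace_gmD (by have := l.2; omega), smul_zero]⟩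

/-- **TRACE-ORTHONORMALITY**: `tr (gellMann a · gellMann b) = δ_{ab}`. [folklore] -/
theorem gellMann_orth : ∀ a b : GMIndex N, form 1 (gellMann a) (gellMann b) = if a = b then 1 else 0 := by
  have h2 : (Real.sqrt 2)⁻¹ * (Real.sqrt 2)⁻¹ * 2 = (1 : ℝ) := by
    rw [← mul_inv, Real.mul_self_sqrt (by norm_num : (0 : ℝ) ≤ 2), inv_mul_cancel₀ (by norm_num : (2 : ℝ) ≠ 0)]
  have hD : ∀ l : ℕ, (Real.sqrt (((l : ℝ) + 1) * ((l : ℝ) + 2)))⁻¹ * (Real.sqrt (((l : ℝ) + 1) * ((l : ℝ) + 2)))⁻¹ *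
      (((l : ℝ) + 1) * ((l : ℝ) + 2)) = 1 := by
    intro l
    have hx : (0 : ℝ) < ((l : ℝ) + 1) * ((l : ℝ) + 2) := by positivity
    rw [← mul_inv, Real.mul_self_sqrt hx.le, inv_mul_cancel₀ hx.ne']
  rintro ((⟨⟨j, k⟩, hjk⟩ | ⟨⟨j, k⟩, hjk⟩) | l) ((⟨⟨j', k'⟩, hjk'⟩ | ⟨⟨j', k'⟩, hjk'⟩) | l') <;>
    simp only [gellMann, form_smul_smul, Sum.inl.injEq, Sum.inr.injEq, Subtype.mk.injEq, Prod.mk.injEq,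
      reduceCtorEq, if_false]
  · rw [form_gmS_gmS hjk hjk']
    split_ifs
    · exact h2
    · exact mul_zero _
  · rw [form_gmS_gmA, mul_zero]
  · rw [form_gmS_gmD hjk, mul_zero]
  · rw [form_gmA_gmS, mul_zero]
  · rw [form_gmA_gmA hjk hjk']
    split_ifs
    · exact h2
    · exact mul_zero _
  · rw [form_gmA_gmD, mul_zero]
  · rw [form_comm, form_gmS_gmD hjk', mul_zero]
  · rw [form_comm, form_gmA_gmD, mul_zero]
  · rw [form_gmD_gmD]
    have hl : (l : ℕ) + 2 ≤ N := by have := l.2; omega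
    have hl' : (l' : ℕ) + 2 ≤ N := by have := l'.2; omega
    by_cases h : l = l'
    · subst h
      rw [if_pos rfl, sum_range_dcoef_mul_self hl]
      exact hD l
    · rw [if_neg h, sum_range_dcoef_mul_dcoef_of_ne (Fin.val_ne_of_ne h) hl hl', mul_zero]

end GellMann

/-! ### Completeness, `hRm` for every `N`, the rescaled and the `Fin`-indexed families, and u(N) -/

section Complete

open Module

variable {N : ℕ}

/-- For `N = 2` the symmetric generator IS `σ₁`. [folklore] -/
theorem gmS_fin_two : gmS (0 : Fin 2) 1 = σ₁ := by
  ext i j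
  fin_cases i <;> fin_cases j <;> simp [gmS_apply, σ₁]

/-- For `N = 2` the antisymmetric generator IS `σ₂`. [folklore] -/
theorem gmA_fin_two : gmA (0 : Fin 2) 1 = σ₂ := by
  ext i j
  fin_cases i <;> fin_cases j <;> simp [gmA_apply, σ₂]

/-- For `N = 2` the diagonal generator IS `σ₃`. [folklore] -/
theorem gmD_fin_two : gmD 2 0 = σ₃ := by
  ext i j
  fin_cases i <;> fin_cases j <;> simp [gmD_apply, dcoef, σ₃]

/-- **COMPLETENESS ON su(N)**: `Σ_a (gellMann a · X) gellMann a = X` for every traceless hermitian `X` — the family is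
trace-orthonormal with `card (GMIndex N) = N² − 1 = dim_ℝ (herm0 (Fin N))` members (§6 `finrank_herm0`), hence an
orthonormal basis. [folklore] -/
theorem gellMann_complete : ∀ X : Matrix (Fin N) (Fin N) ℂ, X.IsHermitian → trace X = 0 →
    ∑ a, form 1 (gellMann a) X • gellMann a = X := by
  intro X hX hX0
  have hcard : Fintype.card (GMIndex N) = finrank ℝ (herm0 (Fin N)) := by
    rw [card_GMIndex, finrank_herm0, Fintype.card_fin]
  exact complete_of_form_orthonormal_card_eq (form 1) (herm0 (Fin N)) gellMann gellMann_mem gellMann_orth hcard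
    X ⟨hX, hX0⟩

/-- **`hRm` HYPOTHESIS-FREE FOR EVERY `N` AND EVERY UNITARY BACKGROUND, in the EXPLICIT generalized Gell-Mann
components** (the all-`N` analogue of §4's `hRm_pauli`; trace form `tr XY`, `c = 1`).
[cite: Balaban1985BackgroundPropagators, p.390 + p.392] -/
theorem hRm_gellMann {Bd : Type*} (U : Bd → Matrix (Fin N) (Fin N) ℂ)
    (hU : ∀ b, U b ∈ Matrix.unitaryGroup (Fin N) ℂ) :
    ∀ b i j, ∑ k, compMat 1 gellMann U b k i * compMat 1 gellMann U b k j = if i = j then 1 else 0 :=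
  compMat_orthogonal_herm0 1 gellMann gellMann_mem gellMann_orth gellMann_complete U hU

/-- THE FAMILY RESCALED for the trace form `form c` (`c > 0`; the print's normalised trace is `c = 1/N`):
`gellMannC c a = (√c)⁻¹ · gellMann a`. [folklore] -/
def gellMannC (c : ℝ) : GMIndex N → Matrix (Fin N) (Fin N) ℂ := fun a => (Real.sqrt c)⁻¹ • gellMann a

/-- The rescaled components are traceless hermitian. [folklore] -/
theorem gellMannC_mem (c : ℝ) : ∀ a : GMIndex N, (gellMannC c a).IsHermitian ∧ trace (gellMannC c a) = 0 :=
  fun a => ⟨(gellMann_mem a).1.smul (IsSelfAdjoint.all _), by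
    rw [gellMannC, trace_smul, (gellMann_mem a).2, smul_zero]⟩

/-- The rescaled components are `form c`-orthonormal. [folklore] -/
theorem gellMannC_orth {c : ℝ} (hc : 0 < c) :
    ∀ a b : GMIndex N, form c (gellMannC c a) (gellMannC c b) = if a = b then 1 else 0 :=
  orth_rescale hc gellMann gellMann_orth

/-- The rescaled components are `form c`-complete on su(N). [folklore] -/
theorem gellMannC_complete {c : ℝ} (hc : 0 < c) : ∀ X : Matrix (Fin N) (Fin N) ℂ, X.IsHermitian → trace X = 0 →
    ∑ a, form c (gellMannC c a) X • gellMannC c a = X :=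
  fun X hX hX0 => complete_rescale hc gellMann {X | X.IsHermitian ∧ trace X = 0}
    (fun X hX => gellMann_complete X hX.1 hX.2) X ⟨hX, hX0⟩

/-- **`hRm` FOR EVERY `N`, EVERY `c > 0`, EVERY UNITARY BACKGROUND, explicit components `gellMannC c`.**
[cite: Balaban1985BackgroundPropagators, p.390 + p.392] -/
theorem hRm_gellMannC {c : ℝ} (hc : 0 < c) {Bd : Type*} (U : Bd → Matrix (Fin N) (Fin N) ℂ)
    (hU : ∀ b, U b ∈ Matrix.unitaryGroup (Fin N) ℂ) :
    ∀ b i j, ∑ k, compMat c (gellMannC c) U b k i * compMat c (gellMannC c) U b k j = if i = j then 1 else 0 :=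
  compMat_orthogonal_herm0 c (gellMannC c) (gellMannC_mem c) (gellMannC_orth hc) (gellMannC_complete hc) U hU

variable (N) in
/-- AN ENUMERATION of the su(N) component index by `Fin (N² − 1)` (it exists by `card_GMIndex`; which enumeration
is immaterial, `gellMannFin_spec` holds for every `ε`). [folklore] -/
def gmEnum : Fin (N ^ 2 - 1) ≃ GMIndex N := (Fintype.equivFinOfCardEq (card_GMIndex N)).symm

/-- THE `Fin (N² − 1)`-INDEXED explicit family for `form c` along an enumeration `ε`. [folklore] -/
def gellMannFin (c : ℝ) (ε : Fin (N ^ 2 - 1) ≃ GMIndex N) : Fin (N ^ 2 - 1) → Matrix (Fin N) (Fin N) ℂ :=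
  fun k => gellMannC c (ε k)

/-- **THE v1.2 WITNESS MADE EXPLICIT (su(N))**: for every `c > 0`, every enumeration `ε` and every unitary background,
`gellMannFin c ε` has exactly the four properties of the `∃ e : Fin (N² − 1) → …` of `exists_hRm_suN` — traceless
hermitian, `form c`-orthonormal, complete on su(N), and `hRm`; so `exists_hRm_suN N hc U hU` is witnessed by
`⟨gellMannFin c (gmEnum N), gellMannFin_spec hc (gmEnum N) U hU⟩` (no Gram–Schmidt).
[cite: Balaban1985BackgroundPropagators, p.390 + p.392] -/
theorem gellMannFin_spec {c : ℝ} (hc : 0 < c) (ε : Fin (N ^ 2 - 1) ≃ GMIndex N) {Bd : Type*}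
    (U : Bd → Matrix (Fin N) (Fin N) ℂ) (hU : ∀ b, U b ∈ Matrix.unitaryGroup (Fin N) ℂ) :
    (∀ k, (gellMannFin c ε k).IsHermitian ∧ trace (gellMannFin c ε k) = 0) ∧
      (∀ k l, form c (gellMannFin c ε k) (gellMannFin c ε l) = if k = l then 1 else 0) ∧
      (∀ X : Matrix (Fin N) (Fin N) ℂ, X.IsHermitian → trace X = 0 →
        ∑ k, form c (gellMannFin c ε k) X • gellMannFin c ε k = X) ∧
      ∀ b i j, ∑ k, compMat c (gellMannFin c ε) U b k i * compMat c (gellMannFin c ε) U b k j =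
        if i = j then 1 else 0 := by
  have hmem : ∀ k, (gellMannFin c ε k).IsHermitian ∧ trace (gellMannFin c ε k) = 0 :=
    fun k => gellMannC_mem c (ε k)
  have horth : ∀ k l, form c (gellMannFin c ε k) (gellMannFin c ε l) = if k = l then 1 else 0 :=
    orth_reindex c (gellMannC c) ε (gellMannC_orth hc)
  have hcompl : ∀ X ∈ {X : Matrix (Fin N) (Fin N) ℂ | X.IsHermitian ∧ trace X = 0},
      ∑ k, form c (gellMannFin c ε k) X • gellMannFin c ε k = X :=
    complete_reindex c (gellMannC c) ε {X | X.IsHermitian ∧ trace X = 0}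
      (fun X hX => gellMannC_complete hc X hX.1 hX.2)
  exact ⟨hmem, horth, fun X hX hX0 => hcompl X ⟨hX, hX0⟩,
    compMat_orthogonal_herm0 c (gellMannFin c ε) hmem horth (fun X hX hX0 => hcompl X ⟨hX, hX0⟩) U hU⟩

/-! ### u(N): the identity component adjoined -/

variable (N) in
/-- **THE EXPLICIT u(N) FAMILY**: the generalized Gell-Mann components and the normalised identity `1/√N`
(trace form `tr XY`). [folklore] -/
def gellMannU : Option (GMIndex N) → Matrix (Fin N) (Fin N) ℂ
  | none => (Real.sqrt N)⁻¹ • (1 : Matrix (Fin N) (Fin N) ℂ)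
  | some a => gellMann a

/-- The u(N) components are hermitian. [folklore] -/
theorem gellMannU_isHermitian : ∀ a : Option (GMIndex N), (gellMannU N a).IsHermitian
  | none => Matrix.isHermitian_one.smul (IsSelfAdjoint.all _)
  | some a => (gellMann_mem a).1

/-- `1 · X = Re tr X` for the trace form `form 1`. [folklore] -/
theorem form_one_one (X : Matrix (Fin N) (Fin N) ℂ) : form 1 (1 : Matrix (Fin N) (Fin N) ℂ) X = (trace X).re := by
  rw [form_apply, Matrix.one_mul, one_mul]

/-- **TRACE-ORTHONORMALITY of the u(N) family** (`N ≥ 1`). [folklore] -/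
theorem gellMannU_orth (hN : 1 ≤ N) :
    ∀ a b : Option (GMIndex N), form 1 (gellMannU N a) (gellMannU N b) = if a = b then 1 else 0 := by
  have hN' : (0 : ℝ) < N := by exact_mod_cast hN
  have key : (Real.sqrt N)⁻¹ * (Real.sqrt N)⁻¹ * (N : ℝ) = 1 := by
    rw [← mul_inv, Real.mul_self_sqrt hN'.le, inv_mul_cancel₀ hN'.ne']
  rintro (_ | a) (_ | b) <;> simp only [gellMannU, Option.some.injEq, reduceCtorEq, if_true, if_false]
  · rw [form_smul_smul, form_one_one, trace_one, Fintype.card_fin, Complex.natCast_re]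
    exact key
  · rw [map_smul, LinearMap.smul_apply, form_one_one, (gellMann_mem b).2, Complex.zero_re, smul_zero]
  · rw [form_comm, map_smul, LinearMap.smul_apply, form_one_one, (gellMann_mem a).2, Complex.zero_re, smul_zero]
  · exact gellMann_orth a b

/-- `card (Option (GMIndex N)) = N² = dim_ℝ u(N)` (`N ≥ 1`). [folklore] -/
theorem card_option_GMIndex (hN : 1 ≤ N) : Fintype.card (Option (GMIndex N)) = N ^ 2 := by
  rw [Fintype.card_option, card_GMIndex]
  have := Nat.one_le_pow 2 N hN
  omega

/-- **COMPLETENESS ON u(N)** (`N ≥ 1`): `Σ_a (gellMannU a · X) gellMannU a = X` for every hermitian `X`. [folklore] -/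
theorem gellMannU_complete (hN : 1 ≤ N) : ∀ X : Matrix (Fin N) (Fin N) ℂ, X.IsHermitian →
    ∑ a, form 1 (gellMannU N a) X • gellMannU N a = X := by
  intro X hX
  have hcard : Fintype.card (Option (GMIndex N)) = finrank ℝ (herm (Fin N)) := by
    rw [card_option_GMIndex hN, finrank_herm, Fintype.card_fin]
  exact complete_of_form_orthonormal_card_eq (form 1) (herm (Fin N)) (gellMannU N) gellMannU_isHermitian
    (gellMannU_orth hN) hcard X hX

/-- **`hRm` ON u(N), HYPOTHESIS-FREE FOR EVERY `N ≥ 1` AND EVERY UNITARY BACKGROUND, explicit components.**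
[cite: Balaban1985BackgroundPropagators, p.390 + p.392] -/
theorem hRm_gellMannU (hN : 1 ≤ N) {Bd : Type*} (U : Bd → Matrix (Fin N) (Fin N) ℂ)
    (hU : ∀ b, U b ∈ Matrix.unitaryGroup (Fin N) ℂ) :
    ∀ b i j, ∑ k, compMat 1 (gellMannU N) U b k i * compMat 1 (gellMannU N) U b k j = if i = j then 1 else 0 :=
  compMat_orthogonal_herm 1 (gellMannU N) gellMannU_isHermitian (gellMannU_orth hN) (gellMannU_complete hN) U hU

/-- AN ENUMERATION of the u(N) component index by `Fin (N²)` (`N ≥ 1`). [folklore] -/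
def gmEnumU (hN : 1 ≤ N) : Fin (N ^ 2) ≃ Option (GMIndex N) :=
  (Fintype.equivFinOfCardEq (card_option_GMIndex hN)).symm

/-- THE `Fin (N²)`-INDEXED explicit u(N) family for `form c` along an enumeration `ε`. [folklore] -/
def gellMannUFin (c : ℝ) (ε : Fin (N ^ 2) ≃ Option (GMIndex N)) : Fin (N ^ 2) → Matrix (Fin N) (Fin N) ℂ :=
  fun k => (Real.sqrt c)⁻¹ • gellMannU N (ε k)

/-- **THE v1.2 WITNESS MADE EXPLICIT (u(N))**: for `N ≥ 1`, every `c > 0`, every enumeration `ε` and every unitary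
background, `gellMannUFin c ε` has exactly the four properties of the `∃ e : Fin (N²) → …` of `exists_hRm_uN`; so
`exists_hRm_uN N hc U hU` is witnessed by `⟨gellMannUFin c (gmEnumU hN), gellMannUFin_spec hN hc (gmEnumU hN) U hU⟩`.
[cite: Balaban1985BackgroundPropagators, p.390 + p.392] -/
theorem gellMannUFin_spec (hN : 1 ≤ N) {c : ℝ} (hc : 0 < c) (ε : Fin (N ^ 2) ≃ Option (GMIndex N)) {Bd : Type*}
    (U : Bd → Matrix (Fin N) (Fin N) ℂ) (hU : ∀ b, U b ∈ Matrix.unitaryGroup (Fin N) ℂ) :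
    (∀ k, (gellMannUFin c ε k).IsHermitian) ∧
      (∀ k l, form c (gellMannUFin c ε k) (gellMannUFin c ε l) = if k = l then 1 else 0) ∧
      (∀ X : Matrix (Fin N) (Fin N) ℂ, X.IsHermitian → ∑ k, form c (gellMannUFin c ε k) X • gellMannUFin c ε k = X) ∧
      ∀ b i j, ∑ k, compMat c (gellMannUFin c ε) U b k i * compMat c (gellMannUFin c ε) U b k j =
        if i = j then 1 else 0 := by
  have hmem : ∀ k, (gellMannUFin c ε k).IsHermitian :=
    fun k => (gellMannU_isHermitian (ε k)).smul (IsSelfAdjoint.all _)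
  have horth : ∀ k l, form c (gellMannUFin c ε k) (gellMannUFin c ε l) = if k = l then 1 else 0 :=
    orth_rescale hc (fun k => gellMannU N (ε k)) (orth_reindex 1 (gellMannU N) ε (gellMannU_orth hN))
  have hcompl : ∀ X ∈ {X : Matrix (Fin N) (Fin N) ℂ | X.IsHermitian},
      ∑ k, form c (gellMannUFin c ε k) X • gellMannUFin c ε k = X :=
    complete_rescale hc (fun k => gellMannU N (ε k)) {X | X.IsHermitian}
      (complete_reindex 1 (gellMannU N) ε {X | X.IsHermitian} fun X hX => gellMannU_complete hN X hX)
  exact ⟨hmem, horth, fun X hX => hcompl X hX,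
    compMat_orthogonal_herm c (gellMannUFin c ε) hmem horth (fun X hX => hcompl X hX) U hU⟩

end Complete

end Literature.MathematicalPhysics.QuantumFieldTheory.Balaban1983to89.B9AdOrthogonal

end
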